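import Mathlib.LinearAlgebra.Matrix.GeneralLinearGroup.Card
import Mathlib.LinearAlgebra.FiniteDimensional.Lemmas
import Mathlib.LinearAlgebra.Dual.Lemmas
import Mathlib.Logic.Equiv.Prod
import Literature.Computability.AlgebraicComplexity.Nazarov2023FiniteFieldRankBound
import Literature.Computability.AlgebraicComplexity.MatMul22mRankFiniteField
import HarnessLib

/-!
# Nazarov 2023, case `s > n = 2`: `R_F(⟨2,s,m⟩) ≥ (s + 1)(1 + 1/K^s) m` over a finite field

Topic `Literature/Computability/AlgebraicComplexity` (bilinear complexity of small formats over finite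
fields). PROVED theorems, no named facts: the case `s > n = 2` (`f(K,2,s) = K^s + 1`) of the named fact
`nazarov2023_rank_matMulTensor_ge` (`Nazarov2023FiniteFieldRankBound.lean`), by the printed proof
(Nazarov 2023, §3: Lemmas 3, 5, 6, 7, 8 and the optimisation in `p` on pp. 47–49):

* **Theorem (case `s > n = 2`).** For a finite field `F` with `K` elements, `s ≥ 3` and every `m`,
  `K^s · R_F(⟨2,s,m⟩) ≥ (K^s + 1)(s + 1) m` (`nazarov2023_rank_matMulTensor_2sm_ge`; rational form
  `…_ge'`; the fact's own wording for `n = 2 < s`: `nazarov2023_rank_matMulTensor_ge_case_n2`).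
* Over a field with two elements: `2 R(⟨2,3,m⟩) ≥ 9 m`, e.g. `R_𝔽₂(⟨2,3,5⟩) ≥ 23` (the any-field bound
  of the tree is `22`, `twentytwo_le_tensorRank_matMulTensor_235`).

(The case `s = n = 2` is Alekseev–Nazarov 2019, `MatMul22mRankFiniteField.lean`; the cases `n ≥ 3` of
the fact need the rank-`r` counts of Lemmas 1–2 and are not treated here — except for their any-field
ingredient, **Lemma 7 for every `2 ≤ n ≤ s`** (`typeStar_bound_general`: if `k` of the `A_t` lie in `L*`
then `d ≥ (n + s − 1) m + k`), proved in the section `General`.)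

## The printed proof and this file

A bilinear computation of `⟨2,s,m⟩` with `d` terms is `xy = ∑_t f_t(x) g_t(y) w_t`
(`BilinComp (mulBilin F 2 s m) ι`); `A_t ∈ F^{2×s}` is the coefficient matrix of `f_t` (`Nazarov2023.A`).

* Lemmas 7 and 8 (`n = 2`): if `k` of the `A_t` lie in the `s`-dimensional subspace `L*`
  (`= ⟨E_{1j} (j < s), E_{1s} − E_{21}⟩`, type `*`, `IsTS`) resp. `L@` (`= ⟨E_{21}, E_{1c} − E_{2,c+1}⟩`,
  type `@`, `IsTA`), then `d ≥ (s + 1) m + k` (`typeStar_bound`, `typeAt_bound`). Both go through one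
  dimension count (`exists_generators`: the printed basis exchange, done as rank–nullity for a
  componentwise row-killing map plus a maximal independent subfamily) followed by the printed
  "all `sm` coefficients are linearly independent" (here: the `g_t`, `t ∈ S`, span all of `(F^{s×m})*`,
  by descending induction on the column for type `@`).
* Lemma 6: `P A_t Q` are the coefficient matrices of an equivalent computation (`twist`).
* Lemma 5: `GL₂(F) × GL_s(F)` acts on `F^{2×s}` (`act`) with orbits `{0}`, rank one (`IsRk1`, base
  point `E_{11}`), rank two (`IsRk2` = independent rows, base point `B2 = (e₁; e₂)`); transitivity
  (`exists_act_B1_eq`, `exists_act_B2_eq`) via "two injective linear maps differ by an automorphism"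
  (`exists_equiv_comp_eq`); `N(A, C)` is constant on orbit pairs and `R_r N_r = |G|` (`card_mul_cnt`);
  `R₂ = (K^s − 1)(K^s − K)` (`card_rk2`, from `card_linearIndependent`), `1 + R₁ + R₂ = K^{2s}`.
* The elements of `L*`, `L@` by rank (p. 47): `v*₁ = K^{s−1} − 1`, `v*₂ = K^s − K^{s−1}`, `v@₁ = K − 1`,
  `v@₂ = K^s − K` (`card_TS_rk1`, `card_TS_rk2`, `card_TA_rk1`, `card_TA_rk2`, via the parametrisations
  `mkS`, `mkA` by one row and a `2 × 2` minor).
* Lemma 3 and the Theorem: double counting and pigeonhole (`exists_good`) for each type, then the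
  printed optimisation over `p = d₁/d` (crossing point `p₀ = (K + 1)/(K^s + 1)`), here as the integer
  certificate `arith`: `2K(K^{s−1} − 1)·(type *) + (K K^{s−1}(K^{s−1} − K − 2) + K^{s−1} + K)·(type @)`
  gives `(K^s + 1)((s+1) m + d₀) + d₁ + d₂ ≤ (K^s + 1) d`.

## References

* A. A. Nazarov, *O nizhnei otsenke bilineinoi slozhnosti umnozheniya matrits nad konechnym polem*,
  Vestn. Mosk. Univ. Ser. 15 Vychisl. Mat. Kibern. 2023, no. 4, 41–53 (transl. Mosc. Univ. Comput.
  Math. Cybern. 47 (2023) 218–231), Theorem p. 42, §3 Lemmas 1–8. [Nazarov2023FiniteFieldLB]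
* V. B. Alekseev, A. A. Nazarov, Vestn. Mosk. Univ. Ser. 15 (2019) no. 4, 5–10 (the case `s = n = 2`
  and Lemma 6 = their Lemma 5). [AlekseevNazarov2019]
-/

namespace Literature.Computability.AlgebraicComplexity

open Module Matrix

namespace Nazarov2023

variable {F : Type*} [Field F] {s m : ℕ} {ι : Type*} [Fintype ι]

/-- The dual of `F^{s×m}` (the `y`-forms). [cite: Nazarov2023FiniteFieldLB, §3 (the matrices `B_t`)] -/
abbrev Yd (F : Type*) [Field F] (s m : ℕ) := Module.Dual F (Matrix (Fin s) (Fin m) F)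

/-- The coordinate functional `y ↦ y_{lj}`. [cite: Nazarov2023FiniteFieldLB, §3] -/
def yc (l : Fin s) (j : Fin m) : Yd F s m where
  toFun y := y l j
  map_add' _ _ := rfl
  map_smul' _ _ := rfl

/-- `yc l j y = y l j`. [cite: Nazarov2023FiniteFieldLB, §3] -/
@[simp] theorem yc_apply (l : Fin s) (j : Fin m) (y : Matrix (Fin s) (Fin m) F) : yc l j y = y l j := rfl

/-- Expansion of a `y`-form in the coordinate functionals. [folklore] -/
private theorem dual_eq_sum_yc (φ : Yd F s m) :
    φ = ∑ l, ∑ j, φ (Matrix.single l j 1) • (yc l j : Yd F s m) := by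
  ext y
  conv_lhs => rw [Matrix.matrix_eq_sum_single y]
  simp only [map_sum, LinearMap.coe_sum, Finset.sum_apply, LinearMap.smul_apply, yc_apply,
    smul_eq_mul]
  refine Finset.sum_congr rfl fun l _ => Finset.sum_congr rfl fun j _ => ?_
  rw [show Matrix.single l j (y l j) = y l j • Matrix.single l j (1 : F) by
    rw [Matrix.smul_single, smul_eq_mul, mul_one], map_smul, smul_eq_mul, mul_comm]

/-- `dim (F^{s×m})* = s m`. [folklore] -/
private theorem finrank_Yd : finrank F (Yd F s m) = s * m := by
  rw [Subspace.dual_finrank_eq, Module.finrank_matrix]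
  simp

/-- The coordinate functionals of one row are linearly independent. [folklore] -/
private theorem linearIndependent_yc (l : Fin s) : LinearIndependent F (fun j : Fin m => (yc l j : Yd F s m)) := by
  rw [Fintype.linearIndependent_iff]
  intro c hc j
  have h := LinearMap.congr_fun hc (Matrix.single l j (1 : F))
  simp only [LinearMap.coe_sum, Finset.sum_apply, LinearMap.smul_apply, yc_apply, smul_eq_mul,
    LinearMap.zero_apply] at h
  rw [Finset.sum_eq_single j (fun j' _ hj => by
      rw [Matrix.single_apply_of_col_ne l l (Ne.symm hj) (1 : F), mul_zero]) (by simp)] at h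
  simpa using h

/-- The forms of `(F^{s×m})*` killing every matrix with zero row `r` are the combinations of the
coordinates of row `r`. [folklore] -/
private theorem mem_span_yc_of_vanish (r : Fin s) (φ : Yd F s m)
    (h : ∀ (l : Fin s) (j : Fin m), l ≠ r → φ (Matrix.single l j 1) = 0) :
    φ ∈ Submodule.span F (Set.range fun j : Fin m => (yc r j : Yd F s m)) := by
  rw [dual_eq_sum_yc φ]
  refine Submodule.sum_mem _ fun l _ => Submodule.sum_mem _ fun j _ => ?_
  by_cases hl : l = r
  · subst hl
    exact Submodule.smul_mem _ _ (Submodule.subset_span ⟨j, rfl⟩)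
  · rw [h l j hl, zero_smul]
    exact zero_mem _

/-- Zeroing row `r` of `y`. [folklore] -/
def zeroRow (r : Fin s) : Matrix (Fin s) (Fin m) F →ₗ[F] Matrix (Fin s) (Fin m) F where
  toFun y := Matrix.updateRow y r 0
  map_add' y y' := by
    ext l j
    by_cases hl : l = r
    · subst hl; simp
    · simp [Matrix.updateRow_ne hl]
  map_smul' a y := by
    ext l j
    by_cases hl : l = r
    · subst hl; simp
    · simp [Matrix.updateRow_ne hl]

/-- `zeroRow r y` off row `r`. [folklore] -/
private theorem zeroRow_apply_ne {r l : Fin s} (hl : l ≠ r) (y : Matrix (Fin s) (Fin m) F) (j : Fin m) :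
    zeroRow r y l j = y l j := by
  simp [zeroRow, Matrix.updateRow_ne hl]

/-- `zeroRow r y` on row `r`. [folklore] -/
private theorem zeroRow_apply_self (r : Fin s) (y : Matrix (Fin s) (Fin m) F) (j : Fin m) :
    zeroRow r y r j = 0 := by
  simp [zeroRow]

/-- Restricting a `y`-form to matrices with zero row `r` (`φ ↦ φ ∘ zeroRow r`). [folklore] -/
def killRow (r : Fin s) : Yd F s m →ₗ[F] Yd F s m := LinearMap.lcomp F F (zeroRow r)

/-- `killRow r φ y = φ (zeroRow r y)`. [folklore] -/
@[simp] private theorem killRow_apply (r : Fin s) (φ : Yd F s m) (y : Matrix (Fin s) (Fin m) F) :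
    killRow r φ y = φ (zeroRow r y) := rfl

/-- `killRow r` kills the coordinates of row `r`. [folklore] -/
private theorem killRow_yc_self (r : Fin s) (j : Fin m) : killRow r (yc r j : Yd F s m) = 0 := by
  ext y
  simp [zeroRow_apply_self]

/-- The kernel of `killRow r` consists of combinations of the coordinates of row `r`. [folklore] -/
private theorem mem_span_yc_of_killRow_eq {r : Fin s} {φ ψ : Yd F s m} (h : killRow r φ = killRow r ψ) :
    φ - ψ ∈ Submodule.span F (Set.range fun j : Fin m => (yc r j : Yd F s m)) := by
  refine mem_span_yc_of_vanish r _ fun l j hl => ?_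
  have h1 := LinearMap.congr_fun h (Matrix.single l j 1)
  simp only [killRow_apply] at h1
  have hz : zeroRow r (Matrix.single l j (1 : F)) = Matrix.single l j 1 := by
    ext l' j'
    by_cases hl' : l' = r
    · subst hl'
      rw [zeroRow_apply_self]
      exact (Matrix.single_apply_of_row_ne hl j j' 1).symm
    · rw [zeroRow_apply_ne hl']
  rw [hz] at h1
  simp [h1]

/-! ## The dimension count behind Lemmas 7 and 8 -/

/-- Rank–nullity as an inequality: if `N ≤ V` is killed by `f` then `dim f(V) + dim N ≤ dim V`.
[folklore] -/
private theorem finrank_map_add_le {M M' : Type*} [AddCommGroup M] [Module F M] [AddCommGroup M']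
    [Module F M'] [FiniteDimensional F M] (f : M →ₗ[F] M') (V N : Submodule F M) (hNV : N ≤ V)
    (hNf : N ≤ LinearMap.ker f) : finrank F (V.map f) + finrank F N ≤ finrank F V := by
  have hrn := LinearMap.finrank_range_add_finrank_ker (f.domRestrict V)
  rw [LinearMap.range_domRestrict, LinearMap.ker_domRestrict] at hrn
  have hN : finrank F N ≤ finrank F ((LinearMap.ker f).comap V.subtype) := by
    have h2 : finrank F (N.comap V.subtype) = finrank F N := by
      have := Submodule.finrank_map_subtype_eq V (N.comap V.subtype)
      rw [Submodule.map_comap_subtype, inf_eq_right.2 hNV] at this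
      exact this.symm
    rw [← h2]
    exact Submodule.finrank_mono (Submodule.comap_mono hNf)
  omega

section Generic

variable {κ : Type*} [Fintype κ]

/-- **The common dimension count of Lemmas 7 and 8.** Rank-one vectors of `y`-forms
`D_t = a_t ⊗ g_t ∈ (F^{s×m})*^κ`, a subspace `N` of their span of dimension `≥ m` killed by the
componentwise maps `τ_c`: then there are indices `S`, `|S| + m + #{t : a_t = 0} ≤ d`, such that every
component of every vector in the span is, modulo `ker τ_c`, a combination of the `g_t`, `t ∈ S` (the
printed basis exchange "новый базис в `U`, состоящий из … и `q − m` билинейных форм `D_t`" and the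
count of "линейно независимых коэффициентов"). [cite: Nazarov2023FiniteFieldLB, Lemma 7 (proof) and Lemma 8 (proof)] -/
theorem exists_generators [DecidableEq F] (a : ι → κ → F) (g : ι → Yd F s m) (τ : κ → (Yd F s m →ₗ[F] Yd F s m))
    (v : Fin m → κ → Yd F s m) (hv : LinearIndependent F v)
    (hvV : ∀ j, v j ∈ Submodule.span F (Set.range fun t => fun c => a t c • g t))
    (hvker : ∀ j c, τ c (v j c) = 0) :
    ∃ S : Finset ι, S.card + m + (Finset.univ.filter fun t => a t = 0).card ≤ Fintype.card ι ∧
      ∀ T ∈ Submodule.span F (Set.range fun t => fun c => a t c • g t), ∀ c,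
        ∃ u ∈ Submodule.span F (g '' (S : Set ι)), τ c u = τ c (T c) := by
  classical
  let D : ι → κ → Yd F s m := fun t c => a t c • g t
  let V : Submodule F (κ → Yd F s m) := Submodule.span F (Set.range D)
  let N : Submodule F (κ → Yd F s m) := Submodule.span F (Set.range v)
  have hNm : finrank F N = m := by rw [finrank_span_eq_card hv, Fintype.card_fin]
  have hNV : N ≤ V := Submodule.span_le.2 (by rintro _ ⟨j, rfl⟩; exact hvV j)
  set Z : Finset ι := Finset.univ.filter fun t => a t = 0 with hZdef
  have hDZ : ∀ t ∈ Z, D t = 0 := fun t ht => by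
    have h0 : a t = 0 := (Finset.mem_filter.1 ht).2
    funext c
    simp [D, h0]
  -- dim V ≤ d − |Z|
  have hVle : finrank F V + Z.card ≤ Fintype.card ι := by
    have hle : V ≤ Submodule.span F (↑((Zᶜ).image D) : Set (κ → Yd F s m)) := by
      rw [Submodule.span_le]
      rintro _ ⟨t, rfl⟩
      by_cases ht : t ∈ Z
      · rw [hDZ t ht]; exact zero_mem _
      · refine Submodule.subset_span ?_
        rw [Finset.coe_image]
        exact ⟨t, by simpa using ht, rfl⟩
    have h1 : finrank F (Submodule.span F (↑((Zᶜ).image D) : Set (κ → Yd F s m))) ≤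
        ((Zᶜ).image D).card := finrank_span_finset_le_card (R := F) _
    have h2 : ((Zᶜ).image D).card ≤ Zᶜ.card := Finset.card_image_le
    rw [Finset.card_compl] at h2
    have h3 : Z.card ≤ Fintype.card ι := Finset.card_le_univ _
    have h4 := Submodule.finrank_mono hle
    omega
  -- the componentwise map `ρ`
  let ρ : (κ → Yd F s m) →ₗ[F] (κ → Yd F s m) :=
    LinearMap.pi fun c => (τ c).comp (LinearMap.proj c)
  have hρ : ∀ (x : κ → Yd F s m) (c : κ), ρ x c = τ c (x c) := fun x c => rfl
  have hNker' : N ≤ LinearMap.ker ρ := by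
    refine Submodule.span_le.2 ?_
    rintro _ ⟨j, rfl⟩
    rw [SetLike.mem_coe, LinearMap.mem_ker]
    funext c
    rw [hρ]
    exact hvker j c
  have hmap : finrank F (V.map ρ) + m ≤ finrank F V := by
    have := finrank_map_add_le (F := F) ρ V N hNV hNker'
    omega
  -- a maximal independent subfamily `S` of the `ρ D_t`
  obtain ⟨s0, hli, hmax⟩ := exists_maximal_linearIndepOn F (fun t => ρ (D t))
  let S : Finset ι := s0.toFinset
  have hSs : (S : Set ι) = s0 := by simp [S]
  have hspanS : Submodule.span F ((fun t => ρ (D t)) '' s0) = V.map ρ := by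
    rw [Submodule.map_span, ← Set.range_comp]
    apply le_antisymm
    · exact Submodule.span_mono (Set.image_subset_range _ _)
    · rw [Submodule.span_le]
      rintro _ ⟨t, rfl⟩
      by_cases hts : t ∈ s0
      · exact Submodule.subset_span ⟨t, hts, rfl⟩
      · obtain ⟨b, hb, hbt⟩ := hmax t hts
        have := Submodule.smul_mem _ b⁻¹ hbt
        rwa [smul_smul, inv_mul_cancel₀ hb, one_smul] at this
  have hScard : S.card = finrank F (V.map ρ) := by
    have hcard := finrank_span_eq_card hli.linearIndependent
    have hrange : Set.range (fun x : ↥s0 => ρ (D x)) = (fun t => ρ (D t)) '' s0 := by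
      ext φ; simp
    rw [hrange, hspanS] at hcard
    rw [show S.card = Fintype.card ↥s0 from by simp [S, Set.toFinset_card]]
    exact hcard.symm
  refine ⟨S, by rw [hScard]; omega, fun T hT c => ?_⟩
  have hmem : ρ T ∈ Submodule.span F ((fun t => ρ (D t)) '' (S : Set ι)) := by
    rw [hSs, hspanS]
    exact Submodule.mem_map_of_mem hT
  obtain ⟨coef, hcoef⟩ := (Submodule.mem_span_image_finset_iff_exists_fun' (R := F)).1 hmem
  refine ⟨∑ t ∈ S, (coef t * a t c) • g t, ?_, ?_⟩
  · exact Submodule.sum_mem _ fun t ht =>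
      Submodule.smul_mem _ _ (Submodule.subset_span ⟨t, Finset.mem_coe.2 ht, rfl⟩)
  · have h1 := congrFun hcoef c
    rw [hρ] at h1
    rw [← h1, map_sum]
    simp only [Finset.sum_apply, Pi.smul_apply, hρ, D, map_smul, smul_smul]

end Generic

/-! ## The computation and its coefficient matrices -/

section Computation

variable (β : BilinComp (mulBilin F 2 s m) ι)

/-- The coefficient matrix `A_t ∈ F^{2×s}` of the form `f_t`. [cite: Nazarov2023FiniteFieldLB, §3 (the matrices `A_t`)] -/
def A (t : ι) : Matrix (Fin 2) (Fin s) F := Matrix.of fun i l => β.f t (Matrix.single i l 1)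

/-- Entries of `A_t`. [cite: Nazarov2023FiniteFieldLB, §3] -/
@[simp] theorem A_apply (t : ι) (i : Fin 2) (l : Fin s) : A β t i l = β.f t (Matrix.single i l 1) := rfl

/-- `f_t(x) = ∑ x_{il} (A_t)_{il}`. [cite: Nazarov2023FiniteFieldLB, §3 (2)] -/
theorem f_eq_sum (t : ι) (x : Matrix (Fin 2) (Fin s) F) :
    β.f t x = ∑ i, ∑ l, x i l * A β t i l := by
  conv_lhs => rw [Matrix.matrix_eq_sum_single x]
  simp only [map_sum, A_apply]
  refine Finset.sum_congr rfl fun i _ => Finset.sum_congr rfl fun l _ => ?_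
  rw [show Matrix.single i l (x i l) = x i l • Matrix.single i l (1 : F) by
    rw [Matrix.smul_single, smul_eq_mul, mul_one], map_smul, smul_eq_mul]

/-- The computation at `x = E_{il}`, entry `(i, j)`: `∑_t (A_t)_{il} w_t[i,j] g_t = y_{lj}`.
[cite: Nazarov2023FiniteFieldLB, §3 (3), (5)] -/
theorem sum_same (i : Fin 2) (l : Fin s) (j : Fin m) :
    ∑ t, (A β t i l * β.w t i j) • β.g t = (yc l j : Yd F s m) := by
  ext y
  have h := β.map_eq_sum (Matrix.single i l 1) y
  rw [mulBilin_apply] at h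
  have h1 := congrFun (congrFun h i) j
  rw [Matrix.single_mul_apply_same, one_mul] at h1
  simp only [LinearMap.coe_sum, Finset.sum_apply, LinearMap.smul_apply, smul_eq_mul, yc_apply,
    A_apply]
  rw [h1]
  simp only [Matrix.sum_apply, Matrix.smul_apply, smul_eq_mul]
  exact Finset.sum_congr rfl fun t _ => by ring

/-- The computation at `x = E_{il}`, entry `(r, j)`, `r ≠ i`: `∑_t (A_t)_{il} w_t[r,j] g_t = 0`.
[cite: Nazarov2023FiniteFieldLB, §3 (3), (5)] -/
theorem sum_ne (i : Fin 2) (l : Fin s) (r : Fin 2) (j : Fin m) (hr : r ≠ i) :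
    ∑ t, (A β t i l * β.w t r j) • β.g t = (0 : Yd F s m) := by
  ext y
  have h := β.map_eq_sum (Matrix.single i l 1) y
  rw [mulBilin_apply] at h
  have h1 := congrFun (congrFun h r) j
  rw [Matrix.single_mul_apply_of_ne (1 : F) i l r j hr] at h1
  simp only [LinearMap.coe_sum, Finset.sum_apply, LinearMap.smul_apply, smul_eq_mul,
    LinearMap.zero_apply, A_apply]
  rw [h1]
  simp only [Matrix.sum_apply, Matrix.smul_apply, smul_eq_mul]
  exact Finset.sum_congr rfl fun t _ => by ring

end Computation

/-! ## Lemma 7 (`n = 2`): forms of type `*` -/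

section TypeLemmas

variable (β : BilinComp (mulBilin F 2 s m) ι)

/-- The first column index. [cite: Nazarov2023FiniteFieldLB, §3] -/
def c0 (hs : 2 ≤ s) : Fin s := ⟨0, by omega⟩

/-- The last column index `s − 1` (written `s` in the source). [cite: Nazarov2023FiniteFieldLB, §3] -/
def cl (hs : 2 ≤ s) : Fin s := ⟨s - 1, by omega⟩

omit [Field F] [Fintype ι] in
/-- `0 ≠ s − 1` as `s ≥ 2`. [cite: Nazarov2023FiniteFieldLB, §3] -/
theorem c0_ne_cl (hs : 2 ≤ s) : c0 hs ≠ cl hs := by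
  intro h
  have := Fin.ext_iff.1 h
  simp only [c0, cl] at this
  omega

/-- The coefficient vector of `f_t` after the substitution of Lemma 7 (`x` zero off the last row and
last column, `x_{1s} = x_{21}`; variables `v_c = x_{2c}`): `a*_t(c) = (A_t)_{2c} + [c = 1] (A_t)_{1s}`.
It vanishes iff `A_t ∈ L*`. [cite: Nazarov2023FiniteFieldLB, Lemma 7 (proof, the matrix `X₁`)] -/
def aS (hs : 2 ≤ s) (t : ι) (c : Fin s) : F := A β t 1 c + if c = c0 hs then A β t 0 (cl hs) else 0

/-- The outputs of the first row after the substitution of Lemma 7: `∑_t w_t[1,j] D*_t = (y_{sj}, 0, …, 0)`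
(the forms `x_{21} y_{sj}`). [cite: Nazarov2023FiniteFieldLB, Lemma 7 (proof, (4))] -/
theorem sum_w0_aS (hs : 2 ≤ s) (j : Fin m) :
    ∑ t, β.w t 0 j • (fun c => aS β hs t c • β.g t) = Pi.single (c0 hs) (yc (cl hs) j : Yd F s m) := by
  funext c
  simp only [Finset.sum_apply, Pi.smul_apply, aS, smul_smul]
  by_cases hc : c = c0 hs
  · subst hc
    simp only [if_true, Pi.single_eq_same]
    rw [← zero_add (yc (cl hs) j : Yd F s m), ← sum_ne β 1 (c0 hs) 0 j (by decide),
      ← sum_same β 0 (cl hs) j, ← Finset.sum_add_distrib]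
    exact Finset.sum_congr rfl fun t _ => by rw [← add_smul]; ring_nf
  · simp only [hc, if_false, add_zero, Pi.single_eq_of_ne hc]
    rw [← sum_ne β 1 c 0 j (by decide)]
    exact Finset.sum_congr rfl fun t _ => by ring_nf

/-- The outputs of the second row after the substitution of Lemma 7: `∑_t w_t[2,j] D*_t = (y_{cj})_c`
(the forms `x_{21} y_{1j} + ⋯ + x_{2s} y_{sj}`). [cite: Nazarov2023FiniteFieldLB, Lemma 7 (proof, (4))] -/
theorem sum_w1_aS (hs : 2 ≤ s) (j : Fin m) :
    ∑ t, β.w t 1 j • (fun c => aS β hs t c • β.g t) = fun c => (yc c j : Yd F s m) := by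
  funext c
  simp only [Finset.sum_apply, Pi.smul_apply, aS, smul_smul]
  by_cases hc : c = c0 hs
  · subst hc
    simp only [if_true]
    rw [← add_zero (yc (c0 hs) j : Yd F s m), ← sum_same β 1 (c0 hs) j,
      ← sum_ne β 0 (cl hs) 1 j (by decide), ← Finset.sum_add_distrib]
    exact Finset.sum_congr rfl fun t _ => by rw [← add_smul]; ring_nf
  · simp only [hc, if_false, add_zero]
    rw [← sum_same β 1 c j]
    exact Finset.sum_congr rfl fun t _ => by ring_nf

/-- **Lemma 7** (`n = 2`): if `k` of the forms `f_t` have `A_t ∈ L*` then `d ≥ (s + 1) m + k`.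
[cite: Nazarov2023FiniteFieldLB, Lemma 7] -/
theorem typeStar_bound [DecidableEq F] (hs : 2 ≤ s) :
    (s + 1) * m + (Finset.univ.filter fun t => aS β hs t = 0).card ≤ Fintype.card ι := by
  classical
  obtain ⟨S, hS, hgen⟩ := exists_generators (aS β hs) β.g
    (fun c => if c = c0 hs then killRow (cl hs) else LinearMap.id)
    (fun j => Pi.single (c0 hs) (yc (cl hs) j : Yd F s m))
    ((linearIndependent_yc (F := F) (cl hs)).map' (LinearMap.single F (fun _ : Fin s => Yd F s m) (c0 hs))
      (LinearMap.ker_single F (fun _ : Fin s => Yd F s m) (c0 hs)))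
    (fun j => by
      rw [← sum_w0_aS β hs j]
      exact Submodule.sum_mem _ fun t _ => Submodule.smul_mem _ _ (Submodule.subset_span ⟨t, rfl⟩))
    (fun j c => by
      by_cases hc : c = c0 hs
      · subst hc; simp [killRow_yc_self]
      · simp [hc])
  let G : Submodule F (Yd F s m) := Submodule.span F (β.g '' (S : Set ι))
  have hT : ∀ j : Fin m, (fun c => (yc c j : Yd F s m)) ∈
      Submodule.span F (Set.range fun t => fun c => aS β hs t c • β.g t) := fun j => by
    rw [← sum_w1_aS β hs j]
    exact Submodule.sum_mem _ fun t _ => Submodule.smul_mem _ _ (Submodule.subset_span ⟨t, rfl⟩)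
  -- components `c ≠ 1`: exact
  have h1 : ∀ c, c ≠ c0 hs → ∀ j, (yc c j : Yd F s m) ∈ G := by
    intro c hc j
    obtain ⟨u, hu, he⟩ := hgen _ (hT j) c
    simp only [hc, if_false, LinearMap.id_apply] at he
    rw [← he]; exact hu
  -- component `1`: modulo the coordinates of the last row, which are already in `G`
  have h0 : ∀ j, (yc (c0 hs) j : Yd F s m) ∈ G := by
    intro j
    obtain ⟨u, hu, he⟩ := hgen _ (hT j) (c0 hs)
    simp only [if_true] at he
    have hdiff := mem_span_yc_of_killRow_eq he
    have hsub : Submodule.span F (Set.range fun p : Fin m => (yc (cl hs) p : Yd F s m)) ≤ G :=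
      Submodule.span_le.2 (by rintro _ ⟨p, rfl⟩; exact h1 _ (c0_ne_cl hs).symm p)
    have := Submodule.sub_mem _ hu (hsub hdiff)
    rwa [sub_sub_cancel] at this
  have htop : (⊤ : Submodule F (Yd F s m)) ≤ G := by
    intro φ _
    rw [dual_eq_sum_yc φ]
    refine Submodule.sum_mem _ fun c _ => Submodule.sum_mem _ fun j _ => Submodule.smul_mem _ _ ?_
    by_cases hc : c = c0 hs
    · rw [hc]; exact h0 j
    · exact h1 c hc j
  have hfin := Submodule.finrank_mono htop
  rw [finrank_top, finrank_Yd] at hfin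
  have hG : finrank F G ≤ S.card := by
    have h := finrank_span_finset_le_card (R := F) (S.image β.g)
    rw [Finset.coe_image] at h
    exact h.trans Finset.card_image_le
  have : s * m + m = (s + 1) * m := by ring
  omega

/-! ## Lemma 8: forms of type `@` -/

/-- The coefficient vector of `f_t` after the substitution of Lemma 8 (`x_{21} = 0`, `x_{2,c+1} = x_{1c}`;
variables `u_c = x_{1c}`): `a@_t(c) = (A_t)_{1c} + (A_t)_{2,c+1}`. It vanishes iff `A_t ∈ L@`.
[cite: Nazarov2023FiniteFieldLB, Lemma 8 (proof, the matrix `X₁`)] -/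
def aA (t : ι) (c : Fin s) : F :=
  A β t 0 c + if h : c.val + 1 < s then A β t 1 ⟨c.val + 1, h⟩ else 0

omit [Fintype ι] in
/-- The successor column. [cite: Nazarov2023FiniteFieldLB, Lemma 8 (proof)] -/
theorem succ_ne {c : Fin s} (h : c.val + 1 < s) : (⟨c.val + 1, h⟩ : Fin s) ≠ c := by
  intro e
  have := congrArg Fin.val e
  simp at this

/-- The outputs of the first row after the substitution of Lemma 8: `∑_t w_t[1,j] D@_t = (y_{cj})_c`.
[cite: Nazarov2023FiniteFieldLB, Lemma 8 (proof, (6))] -/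
theorem sum_w0_aA (j : Fin m) :
    ∑ t, β.w t 0 j • (fun c => aA β t c • β.g t) = fun c => (yc c j : Yd F s m) := by
  funext c
  simp only [Finset.sum_apply, Pi.smul_apply, aA, smul_smul]
  by_cases hc : c.val + 1 < s
  · simp only [hc, dif_pos]
    rw [← add_zero (yc c j : Yd F s m), ← sum_same β 0 c j,
      ← sum_ne β 1 ⟨c.val + 1, hc⟩ 0 j (by decide), ← Finset.sum_add_distrib]
    exact Finset.sum_congr rfl fun t _ => by rw [← add_smul]; ring_nf
  · simp only [hc, dif_neg, not_false_eq_true, add_zero]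
    rw [← sum_same β 0 c j]
    exact Finset.sum_congr rfl fun t _ => by ring_nf

/-- The outputs of the second row after the substitution of Lemma 8:
`∑_t w_t[2,j] D@_t = (y_{c+1,j})_c` (last component `0`). [cite: Nazarov2023FiniteFieldLB, Lemma 8 (proof, (6))] -/
theorem sum_w1_aA (j : Fin m) :
    ∑ t, β.w t 1 j • (fun c => aA β t c • β.g t) =
      fun c => if h : c.val + 1 < s then (yc ⟨c.val + 1, h⟩ j : Yd F s m) else 0 := by
  funext c
  simp only [Finset.sum_apply, Pi.smul_apply, aA, smul_smul]
  by_cases hc : c.val + 1 < s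
  · simp only [hc, dif_pos]
    rw [← zero_add (yc _ j : Yd F s m), ← sum_ne β 0 c 1 j (by decide),
      ← sum_same β 1 ⟨c.val + 1, hc⟩ j, ← Finset.sum_add_distrib]
    exact Finset.sum_congr rfl fun t _ => by rw [← add_smul]; ring_nf
  · simp only [hc, dif_neg, not_false_eq_true, add_zero]
    rw [← sum_ne β 0 c 1 j (by decide)]
    exact Finset.sum_congr rfl fun t _ => by ring_nf

/-- **Lemma 8**: if `k` of the forms `f_t` have `A_t ∈ L@` then `d ≥ (s + 1) m + k`.
[cite: Nazarov2023FiniteFieldLB, Lemma 8] -/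
theorem typeAt_bound [DecidableEq F] (hs : 2 ≤ s) :
    (s + 1) * m + (Finset.univ.filter fun t => aA β t = 0).card ≤ Fintype.card ι := by
  classical
  have hv : LinearIndependent F (fun j : Fin m => fun c : Fin s =>
      if h : c.val + 1 < s then (yc ⟨c.val + 1, h⟩ j : Yd F s m) else 0) := by
    rw [Fintype.linearIndependent_iff]
    intro coef hcoef j
    have h01 : (c0 hs).val + 1 < s := by simp [c0]; omega
    have h := congrFun hcoef (c0 hs)
    simp only [Finset.sum_apply, Pi.smul_apply, h01, dif_pos, Pi.zero_apply] at h
    exact (Fintype.linearIndependent_iff.1 (linearIndependent_yc (F := F) (m := m)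
      (⟨(c0 hs).val + 1, h01⟩ : Fin s))) coef h j
  obtain ⟨S, hS, hgen⟩ := exists_generators (aA β) β.g
    (fun c => if h : c.val + 1 < s then killRow ⟨c.val + 1, h⟩ else LinearMap.id)
    _ hv
    (fun j => by
      rw [← sum_w1_aA β j]
      exact Submodule.sum_mem _ fun t _ => Submodule.smul_mem _ _ (Submodule.subset_span ⟨t, rfl⟩))
    (fun j c => by
      by_cases hc : c.val + 1 < s
      · simp [hc, killRow_yc_self]
      · simp [hc])
  let G : Submodule F (Yd F s m) := Submodule.span F (β.g '' (S : Set ι))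
  have hT : ∀ j : Fin m, (fun c => (yc c j : Yd F s m)) ∈
      Submodule.span F (Set.range fun t => fun c => aA β t c • β.g t) := fun j => by
    rw [← sum_w0_aA β j]
    exact Submodule.sum_mem _ fun t _ => Submodule.smul_mem _ _ (Submodule.subset_span ⟨t, rfl⟩)
  -- descending induction on the column
  have hind : ∀ k : ℕ, ∀ c : Fin s, c.val + 1 + k = s → ∀ j, (yc c j : Yd F s m) ∈ G := by
    intro k
    induction k with
    | zero =>
      intro c hc j
      obtain ⟨u, hu, he⟩ := hgen _ (hT j) c
      have hc' : ¬(c.val + 1 < s) := by omega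
      simp only [hc', dif_neg, not_false_eq_true, LinearMap.id_apply] at he
      rw [← he]; exact hu
    | succ k ih =>
      intro c hc j
      obtain ⟨u, hu, he⟩ := hgen _ (hT j) c
      have hc' : c.val + 1 < s := by omega
      simp only [hc', dif_pos] at he
      have hdiff := mem_span_yc_of_killRow_eq he
      have hsub : Submodule.span F (Set.range fun p : Fin m =>
          (yc (⟨c.val + 1, hc'⟩ : Fin s) p : Yd F s m)) ≤ G :=
        Submodule.span_le.2 (by
          rintro _ ⟨p, rfl⟩
          exact ih ⟨c.val + 1, hc'⟩ (by simp; omega) p)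
      have := Submodule.sub_mem _ hu (hsub hdiff)
      rwa [sub_sub_cancel] at this
  have hall : ∀ (c : Fin s) (j : Fin m), (yc c j : Yd F s m) ∈ G :=
    fun c j => hind (s - 1 - c.val) c (by omega) j
  have htop : (⊤ : Submodule F (Yd F s m)) ≤ G := by
    intro φ _
    rw [dual_eq_sum_yc φ]
    exact Submodule.sum_mem _ fun c _ => Submodule.sum_mem _ fun j _ =>
      Submodule.smul_mem _ _ (hall c j)
  have hfin := Submodule.finrank_mono htop
  rw [finrank_top, finrank_Yd] at hfin
  have hG : finrank F G ≤ S.card := by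
    have h := finrank_span_finset_le_card (R := F) (S.image β.g)
    rw [Finset.coe_image] at h
    exact h.trans Finset.card_image_le
  have : s * m + m = (s + 1) * m := by ring
  omega

end TypeLemmas

/-! ## Lemma 7 for every `n ≤ s` (any field) -/

section General

variable {κ : Type*} [Fintype κ] {J : Type*} [Fintype J]

/-- `exists_generators` with an arbitrary finite index set for the killed subspace.
[cite: Nazarov2023FiniteFieldLB, Lemma 7 (proof)] -/
theorem exists_generators' [DecidableEq F] (a : ι → κ → F) (g : ι → Yd F s m)
    (τ : κ → (Yd F s m →ₗ[F] Yd F s m)) (v : J → κ → Yd F s m) (hv : LinearIndependent F v)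
    (hvV : ∀ j, v j ∈ Submodule.span F (Set.range fun t => fun c => a t c • g t))
    (hvker : ∀ j c, τ c (v j c) = 0) :
    ∃ S : Finset ι, S.card + Fintype.card J + (Finset.univ.filter fun t => a t = 0).card ≤
      Fintype.card ι ∧
      ∀ T ∈ Submodule.span F (Set.range fun t => fun c => a t c • g t), ∀ c,
        ∃ u ∈ Submodule.span F (g '' (S : Set ι)), τ c u = τ c (T c) := by
  classical
  let D : ι → κ → Yd F s m := fun t c => a t c • g t
  let V : Submodule F (κ → Yd F s m) := Submodule.span F (Set.range D)
  let N : Submodule F (κ → Yd F s m) := Submodule.span F (Set.range v)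
  have hNm : finrank F N = Fintype.card J := by rw [finrank_span_eq_card hv]
  have hNV : N ≤ V := Submodule.span_le.2 (by rintro _ ⟨j, rfl⟩; exact hvV j)
  set Z : Finset ι := Finset.univ.filter fun t => a t = 0 with hZdef
  have hDZ : ∀ t ∈ Z, D t = 0 := fun t ht => by
    have h0 : a t = 0 := (Finset.mem_filter.1 ht).2
    funext c
    simp [D, h0]
  have hVle : finrank F V + Z.card ≤ Fintype.card ι := by
    have hle : V ≤ Submodule.span F (↑((Zᶜ).image D) : Set (κ → Yd F s m)) := by
      rw [Submodule.span_le]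
      rintro _ ⟨t, rfl⟩
      by_cases ht : t ∈ Z
      · rw [hDZ t ht]; exact zero_mem _
      · refine Submodule.subset_span ?_
        rw [Finset.coe_image]
        exact ⟨t, by simpa using ht, rfl⟩
    have h1 : finrank F (Submodule.span F (↑((Zᶜ).image D) : Set (κ → Yd F s m))) ≤
        ((Zᶜ).image D).card := finrank_span_finset_le_card (R := F) _
    have h2 : ((Zᶜ).image D).card ≤ Zᶜ.card := Finset.card_image_le
    rw [Finset.card_compl] at h2
    have h3 : Z.card ≤ Fintype.card ι := Finset.card_le_univ _
    have h4 := Submodule.finrank_mono hle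
    omega
  let ρ : (κ → Yd F s m) →ₗ[F] (κ → Yd F s m) :=
    LinearMap.pi fun c => (τ c).comp (LinearMap.proj c)
  have hρ : ∀ (x : κ → Yd F s m) (c : κ), ρ x c = τ c (x c) := fun x c => rfl
  have hNker' : N ≤ LinearMap.ker ρ := by
    refine Submodule.span_le.2 ?_
    rintro _ ⟨j, rfl⟩
    rw [SetLike.mem_coe, LinearMap.mem_ker]
    funext c
    rw [hρ]
    exact hvker j c
  have hmap : finrank F (V.map ρ) + Fintype.card J ≤ finrank F V := by
    have := finrank_map_add_le (F := F) ρ V N hNV hNker'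
    omega
  obtain ⟨s0, hli, hmax⟩ := exists_maximal_linearIndepOn F (fun t => ρ (D t))
  let S : Finset ι := s0.toFinset
  have hSs : (S : Set ι) = s0 := by simp [S]
  have hspanS : Submodule.span F ((fun t => ρ (D t)) '' s0) = V.map ρ := by
    rw [Submodule.map_span, ← Set.range_comp]
    apply le_antisymm
    · exact Submodule.span_mono (Set.image_subset_range _ _)
    · rw [Submodule.span_le]
      rintro _ ⟨t, rfl⟩
      by_cases hts : t ∈ s0
      · exact Submodule.subset_span ⟨t, hts, rfl⟩
      · obtain ⟨b, hb, hbt⟩ := hmax t hts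
        have := Submodule.smul_mem _ b⁻¹ hbt
        rwa [smul_smul, inv_mul_cancel₀ hb, one_smul] at this
  have hScard : S.card = finrank F (V.map ρ) := by
    have hcard := finrank_span_eq_card hli.linearIndependent
    have hrange : Set.range (fun x : ↥s0 => ρ (D x)) = (fun t => ρ (D t)) '' s0 := by
      ext φ; simp
    rw [hrange, hspanS] at hcard
    rw [show S.card = Fintype.card ↥s0 from by simp [S, Set.toFinset_card]]
    exact hcard.symm
  refine ⟨S, by rw [hScard]; omega, fun T hT c => ?_⟩
  have hmem : ρ T ∈ Submodule.span F ((fun t => ρ (D t)) '' (S : Set ι)) := by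
    rw [hSs, hspanS]
    exact Submodule.mem_map_of_mem hT
  obtain ⟨coef, hcoef⟩ := (Submodule.mem_span_image_finset_iff_exists_fun' (R := F)).1 hmem
  refine ⟨∑ t ∈ S, (coef t * a t c) • g t, ?_, ?_⟩
  · exact Submodule.sum_mem _ fun t ht =>
      Submodule.smul_mem _ _ (Submodule.subset_span ⟨t, Finset.mem_coe.2 ht, rfl⟩)
  · have h1 := congrFun hcoef c
    rw [hρ] at h1
    rw [← h1, map_sum]
    simp only [Finset.sum_apply, Pi.smul_apply, hρ, D, map_smul, smul_smul]

variable {n : ℕ} (β : BilinComp (mulBilin F n s m) ι)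

/-- The coefficient matrix `A_t ∈ F^{n×s}` of `f_t`. [cite: Nazarov2023FiniteFieldLB, §3 (the matrices `A_t`)] -/
def An (t : ι) : Matrix (Fin n) (Fin s) F := Matrix.of fun i l => β.f t (Matrix.single i l 1)

/-- Entries of `A_t`. [cite: Nazarov2023FiniteFieldLB, §3] -/
@[simp] theorem An_apply (t : ι) (i : Fin n) (l : Fin s) : An β t i l = β.f t (Matrix.single i l 1) := rfl

/-- The computation at `x = E_{il}`, entry `(i, j)` (general `n`). [cite: Nazarov2023FiniteFieldLB, §3 (3)] -/
theorem sumn_same (i : Fin n) (l : Fin s) (j : Fin m) :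
    ∑ t, (An β t i l * β.w t i j) • β.g t = (yc l j : Yd F s m) := by
  ext y
  have h := β.map_eq_sum (Matrix.single i l 1) y
  rw [mulBilin_apply] at h
  have h1 := congrFun (congrFun h i) j
  rw [Matrix.single_mul_apply_same, one_mul] at h1
  simp only [LinearMap.coe_sum, Finset.sum_apply, LinearMap.smul_apply, smul_eq_mul, yc_apply,
    An_apply]
  rw [h1]
  simp only [Matrix.sum_apply, Matrix.smul_apply, smul_eq_mul]
  exact Finset.sum_congr rfl fun t _ => by ring

/-- The computation at `x = E_{il}`, entry `(r, j)`, `r ≠ i` (general `n`). [cite: Nazarov2023FiniteFieldLB, §3 (3)] -/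
theorem sumn_ne (i : Fin n) (l : Fin s) (r : Fin n) (j : Fin m) (hr : r ≠ i) :
    ∑ t, (An β t i l * β.w t r j) • β.g t = (0 : Yd F s m) := by
  ext y
  have h := β.map_eq_sum (Matrix.single i l 1) y
  rw [mulBilin_apply] at h
  have h1 := congrFun (congrFun h r) j
  rw [Matrix.single_mul_apply_of_ne (1 : F) i l r j hr] at h1
  simp only [LinearMap.coe_sum, Finset.sum_apply, LinearMap.smul_apply, smul_eq_mul,
    LinearMap.zero_apply, An_apply]
  rw [h1]
  simp only [Matrix.sum_apply, Matrix.smul_apply, smul_eq_mul]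
  exact Finset.sum_congr rfl fun t _ => by ring

/-- The last row index `n − 1`. [cite: Nazarov2023FiniteFieldLB, Lemma 7 (proof)] -/
def rowL (hn : 1 ≤ n) : Fin n := ⟨n - 1, by omega⟩

/-- The last column index `s − 1`. [cite: Nazarov2023FiniteFieldLB, Lemma 7 (proof)] -/
def colL (h1 : 1 ≤ s) : Fin s := ⟨s - 1, by omega⟩

/-- The coefficient vector of `f_t` after the substitution of Lemma 7 for general `n ≤ s` (`x` zero off the
last row and last column, `x_{is} = x_{ni}` for `i < n`; variables `v_c = x_{nc}`):
`a*_t(c) = (A_t)_{nc} + [c < n−1] (A_t)_{c s}`. It vanishes iff `A_t ∈ L*`.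
[cite: Nazarov2023FiniteFieldLB, Lemma 7 (proof, the matrix `X₁`)] -/
def aSn (hn : 1 ≤ n) (hns : n ≤ s) (t : ι) (c : Fin s) : F :=
  An β t (rowL hn) c +
    if h : c.val + 1 < n then An β t ⟨c.val, by omega⟩ (colL (le_trans hn hns)) else 0

/-- **Lemma 7 (general `2 ≤ n ≤ s`, any field).** If `k` of the forms `f_t` have `A_t ∈ L*` then
`d ≥ (n + s − 1) m + k`. [cite: Nazarov2023FiniteFieldLB, Lemma 7] -/
theorem typeStar_bound_general [DecidableEq F] (hn : 2 ≤ n) (hns : n ≤ s) :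
    (n + s - 1) * m + (Finset.univ.filter fun t => aSn β (by omega) hns t = 0).card ≤ Fintype.card ι := by
  classical
  have hn1 : 1 ≤ n := by omega
  have hs1 : 1 ≤ s := le_trans hn1 hns
  have hlast : ∀ i : Fin (n - 1), (⟨i.val, by omega⟩ : Fin n) ≠ rowL hn1 := fun i e => by
    have := Fin.ext_iff.1 e; simp [rowL] at this; omega
  have hcolL : ¬((colL hs1 : Fin s).val + 1 < n) := by simp [colL]; omega
  -- the killed vectors: `v (i, j) = e_i ⊗ y_{s j}` for `i < n − 1`
  let v : Fin (n - 1) × Fin m → Fin s → Yd F s m :=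
    fun p => Pi.single (M := fun _ : Fin s => Yd F s m) (⟨p.1.val, by omega⟩ : Fin s) (yc (colL hs1) p.2)
  have hv_apply : ∀ (p : Fin (n - 1) × Fin m) (c : Fin s),
      v p c = if c.val = p.1.val then (yc (colL hs1) p.2 : Yd F s m) else 0 := by
    intro p c
    simp only [v]
    by_cases hc : c.val = p.1.val
    · rw [if_pos hc, show c = ⟨p.1.val, by omega⟩ from Fin.ext hc, Pi.single_eq_same]
    · rw [if_neg hc, Pi.single_eq_of_ne (fun e => hc (Fin.ext_iff.1 e))]
  have hv : LinearIndependent F v := by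
    rw [Fintype.linearIndependent_iff]
    intro coef hcoef ⟨i, j⟩
    have h := congrFun hcoef ⟨i.val, by omega⟩
    simp only [Finset.sum_apply, Pi.smul_apply, Pi.zero_apply, hv_apply] at h
    rw [← Finset.sum_filter_add_sum_filter_not Finset.univ (fun p : Fin (n - 1) × Fin m => p.1 = i)] at h
    have h0 : ∑ p ∈ Finset.univ.filter (fun p : Fin (n - 1) × Fin m => ¬p.1 = i),
        coef p • (if (⟨i.val, by omega⟩ : Fin s).val = p.1.val then (yc (colL hs1) p.2 : Yd F s m) else 0) = 0 := by
      refine Finset.sum_eq_zero fun p hp => ?_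
      have hp' : ¬p.1 = i := (Finset.mem_filter.1 hp).2
      rw [if_neg (fun e => hp' (Fin.ext (by simpa using e.symm))), smul_zero]
    rw [h0, add_zero] at h
    have h1 : ∑ p ∈ Finset.univ.filter (fun p : Fin (n - 1) × Fin m => p.1 = i),
        coef p • (if (⟨i.val, by omega⟩ : Fin s).val = p.1.val then (yc (colL hs1) p.2 : Yd F s m) else 0) =
        ∑ j' : Fin m, coef (i, j') • (yc (colL hs1) j' : Yd F s m) := by
      rw [show (Finset.univ.filter fun p : Fin (n - 1) × Fin m => p.1 = i) =
          (Finset.univ : Finset (Fin m)).image (fun j' => (i, j')) by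
        ext p
        simp only [Finset.mem_filter, Finset.mem_univ, true_and, Finset.mem_image]
        constructor
        · intro hp; exact ⟨p.2, by rw [← hp]⟩
        · rintro ⟨j', rfl⟩; rfl]
      rw [Finset.sum_image (fun a _ b _ hab => (Prod.mk.inj hab).2)]
      refine Finset.sum_congr rfl fun j' _ => ?_
      rw [if_pos rfl]
    rw [h1] at h
    exact (Fintype.linearIndependent_iff.1 (linearIndependent_yc (F := F) (m := m) (colL hs1)))
      (fun j' => coef (i, j')) h j
  -- the identities `v (i, j) = ∑_t w_t[i, j] D*_t` and `(y_{cj})_c = ∑_t w_t[n, j] D*_t`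
  have hvV : ∀ p : Fin (n - 1) × Fin m,
      v p = ∑ t, β.w t ⟨p.1.val, by omega⟩ p.2 • (fun c => aSn β hn1 hns t c • β.g t) := by
    rintro ⟨i, j⟩
    funext c
    rw [hv_apply]
    simp only [Finset.sum_apply, Pi.smul_apply, aSn, smul_smul]
    by_cases hc : c.val + 1 < n
    · simp only [hc, dif_pos]
      by_cases hci : c.val = i.val
      · rw [if_pos hci, ← zero_add (yc (colL hs1) j : Yd F s m),
          ← sumn_ne β (rowL hn1) c ⟨i.val, by omega⟩ j (hlast i),
          ← sumn_same β ⟨i.val, by omega⟩ (colL hs1) j, ← Finset.sum_add_distrib]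
        refine Finset.sum_congr rfl fun t _ => ?_
        rw [← add_smul, show (⟨c.val, by omega⟩ : Fin n) = ⟨i.val, by omega⟩ from Fin.ext hci]
        ring_nf
      · rw [if_neg hci]
        have e1 := sumn_ne β (rowL hn1) c ⟨i.val, by omega⟩ j (hlast i)
        have e2 := sumn_ne β ⟨c.val, by omega⟩ (colL hs1) ⟨i.val, by omega⟩ j
          (fun e => hci (Fin.ext_iff.1 e).symm)
        rw [← add_zero (0 : Yd F s m)]
        nth_rewrite 1 [← e1]
        rw [← e2, ← Finset.sum_add_distrib]
        exact Finset.sum_congr rfl fun t _ => by rw [← add_smul]; ring_nf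
    · simp only [hc, dif_neg, not_false_eq_true, add_zero]
      rw [if_neg (fun e => hc (by have := i.isLt; omega)),
        ← sumn_ne β (rowL hn1) c ⟨i.val, by omega⟩ j (hlast i)]
      exact Finset.sum_congr rfl fun t _ => by ring_nf
  have hT : ∀ j : Fin m, (fun c => (yc c j : Yd F s m)) =
      ∑ t, β.w t (rowL hn1) j • (fun c => aSn β hn1 hns t c • β.g t) := by
    intro j
    funext c
    simp only [Finset.sum_apply, Pi.smul_apply, aSn, smul_smul]
    by_cases hc : c.val + 1 < n
    · simp only [hc, dif_pos]
      rw [← add_zero (yc c j : Yd F s m), ← sumn_same β (rowL hn1) c j,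
        ← sumn_ne β ⟨c.val, by omega⟩ (colL hs1) (rowL hn1) j (fun e => by
          have := Fin.ext_iff.1 e; simp [rowL] at this; omega), ← Finset.sum_add_distrib]
      exact Finset.sum_congr rfl fun t _ => by rw [← add_smul]; ring_nf
    · simp only [hc, dif_neg, not_false_eq_true, add_zero]
      rw [← sumn_same β (rowL hn1) c j]
      exact Finset.sum_congr rfl fun t _ => by ring_nf
  obtain ⟨S, hS, hgen⟩ := exists_generators' (aSn β hn1 hns) β.g
    (fun c => if c.val + 1 < n then killRow (colL hs1) else LinearMap.id) v hv
    (fun p => by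
      rw [hvV p]
      exact Submodule.sum_mem _ fun t _ => Submodule.smul_mem _ _ (Submodule.subset_span ⟨t, rfl⟩))
    (fun p c => by
      rw [hv_apply]
      by_cases hc : c.val + 1 < n
      · simp only [hc, if_true]
        by_cases hci : c.val = p.1.val
        · rw [if_pos hci, killRow_yc_self]
        · rw [if_neg hci, map_zero]
      · have hci : ¬(c.val = p.1.val) := fun e => hc (by have := p.1.isLt; omega)
        simp only [hc, if_false, hci, map_zero])
  let G : Submodule F (Yd F s m) := Submodule.span F (β.g '' (S : Set ι))
  have hTmem : ∀ j : Fin m, (fun c => (yc c j : Yd F s m)) ∈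
      Submodule.span F (Set.range fun t => fun c => aSn β hn1 hns t c • β.g t) := fun j => by
    rw [hT j]
    exact Submodule.sum_mem _ fun t _ => Submodule.smul_mem _ _ (Submodule.subset_span ⟨t, rfl⟩)
  have h1 : ∀ c : Fin s, ¬(c.val + 1 < n) → ∀ j, (yc c j : Yd F s m) ∈ G := by
    intro c hc j
    obtain ⟨u, hu, he⟩ := hgen _ (hTmem j) c
    simp only [hc, if_false, LinearMap.id_apply] at he
    rw [← he]; exact hu
  have hcl : ∀ j, (yc (colL hs1) j : Yd F s m) ∈ G := fun j => h1 (colL hs1) hcolL j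
  have h0 : ∀ c : Fin s, c.val + 1 < n → ∀ j, (yc c j : Yd F s m) ∈ G := by
    intro c hc j
    obtain ⟨u, hu, he⟩ := hgen _ (hTmem j) c
    simp only [hc, if_true] at he
    have hdiff := mem_span_yc_of_killRow_eq he
    have hsub : Submodule.span F (Set.range fun p : Fin m => (yc (colL hs1) p : Yd F s m)) ≤ G :=
      Submodule.span_le.2 (by rintro _ ⟨p, rfl⟩; exact hcl p)
    have := Submodule.sub_mem _ hu (hsub hdiff)
    rwa [sub_sub_cancel] at this
  have htop : (⊤ : Submodule F (Yd F s m)) ≤ G := by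
    intro φ _
    rw [dual_eq_sum_yc φ]
    refine Submodule.sum_mem _ fun c _ => Submodule.sum_mem _ fun j _ => Submodule.smul_mem _ _ ?_
    by_cases hc : c.val + 1 < n
    · exact h0 c hc j
    · exact h1 c hc j
  have hfin := Submodule.finrank_mono htop
  rw [finrank_top, finrank_Yd] at hfin
  have hG : finrank F G ≤ S.card := by
    have h := finrank_span_finset_le_card (R := F) (S.image β.g)
    rw [Finset.coe_image] at h
    exact h.trans Finset.card_image_le
  have hJ : Fintype.card (Fin (n - 1) × Fin m) = (n - 1) * m := by simp
  rw [hJ] at hS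
  have : (n + s - 1) * m = s * m + (n - 1) * m := by
    rw [show n + s - 1 = s + (n - 1) by omega, add_mul]
  omega

/-- **Corollary (any field, `2 ≤ n ≤ s`)**: a computation of `⟨n,s,m⟩` has at least `(n + s − 1) m` terms —
Lemma 7 with `k = 0`. [cite: Nazarov2023FiniteFieldLB, Lemma 7 (k = 0)] -/
theorem add_sub_one_mul_le_card [DecidableEq F] (β' : BilinComp (mulBilin F n s m) ι) (hn : 2 ≤ n)
    (hns : n ≤ s) : (n + s - 1) * m ≤ Fintype.card ι :=
  le_trans (Nat.le_add_right _ _) (typeStar_bound_general β' hn hns)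

end General

/-! ## Lemma 5: `GL₂(F) × GL_s(F)` acts on `F^{2×s}` with orbits `{0}`, rank one, rank two -/

section LinAlg

/-- Two injective linear maps into the same finite-dimensional space differ by an automorphism of
the target ("любые 2 матрицы `C₁, C₂` из `M` эквивалентны", via complements of the images).
[cite: Nazarov2023FiniteFieldLB, Lemma 5 (proof, citing [12, p. 183])] -/
theorem exists_equiv_comp_eq {V W : Type*} [AddCommGroup V] [Module F V] [AddCommGroup W] [Module F W]
    [FiniteDimensional F V] [FiniteDimensional F W] (f f' : V →ₗ[F] W) (hf : Function.Injective f)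
    (hf' : Function.Injective f') : ∃ θ : W ≃ₗ[F] W, ∀ v, θ (f v) = f' v := by
  obtain ⟨C, hC⟩ := Submodule.exists_isCompl (LinearMap.range f)
  obtain ⟨C', hC'⟩ := Submodule.exists_isCompl (LinearMap.range f')
  have hCC' : finrank F C = finrank F C' := by
    have h1 := Submodule.finrank_add_eq_of_isCompl hC
    have h2 := Submodule.finrank_add_eq_of_isCompl hC'
    rw [LinearMap.finrank_range_of_inj hf] at h1
    rw [LinearMap.finrank_range_of_inj hf'] at h2
    omega
  let eR : LinearMap.range f ≃ₗ[F] LinearMap.range f' :=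
    (LinearEquiv.ofInjective f hf).symm.trans (LinearEquiv.ofInjective f' hf')
  let eC : C ≃ₗ[F] C' := LinearEquiv.ofFinrankEq C C' hCC'
  refine ⟨((Submodule.prodEquivOfIsCompl _ C hC).symm.trans (eR.prodCongr eC)).trans
    (Submodule.prodEquivOfIsCompl _ C' hC'), fun v => ?_⟩
  have hv : f v ∈ LinearMap.range f := LinearMap.mem_range_self f v
  have h1 : (Submodule.prodEquivOfIsCompl _ C hC).symm (f v) =
      ((⟨f v, hv⟩ : LinearMap.range f), (0 : C)) :=
    Submodule.prodEquivOfIsCompl_symm_apply_left _ _ hC (⟨f v, hv⟩ : LinearMap.range f)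
  simp only [LinearEquiv.trans_apply, h1, LinearEquiv.prodCongr_apply, map_zero,
    Submodule.coe_prodEquivOfIsCompl', Submodule.coe_zero, add_zero]
  have h2 : (LinearEquiv.ofInjective f hf).symm (⟨f v, hv⟩ : LinearMap.range f) = v := by
    apply hf
    rw [LinearEquiv.ofInjective_symm_apply]
  simp [eR, h2]

variable {n : ℕ}

/-- The invertible matrix acting (on row vectors, from the right) as a given automorphism of `F^n`.
[folklore] -/
noncomputable def glOfEquiv (θ : (Fin n → F) ≃ₗ[F] (Fin n → F)) : GL (Fin n) F :=
  Matrix.GeneralLinearGroup.mkOfDetNeZero (LinearMap.toMatrix' θ.toLinearMap).transpose (by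
    rw [Matrix.det_transpose]
    refine Matrix.det_ne_zero_of_right_inverse (B := LinearMap.toMatrix' θ.symm.toLinearMap) ?_
    rw [← LinearMap.toMatrix'_comp]
    have : θ.toLinearMap.comp θ.symm.toLinearMap = LinearMap.id := by
      ext v i
      simp
    rw [this, LinearMap.toMatrix'_id])

/-- `v (glOfEquiv θ) = θ v`. [folklore] -/
private theorem vecMul_glOfEquiv (θ : (Fin n → F) ≃ₗ[F] (Fin n → F)) (v : Fin n → F) :
    Matrix.vecMul v (glOfEquiv θ : Matrix (Fin n) (Fin n) F) = θ v := by
  simp only [glOfEquiv, Matrix.GeneralLinearGroup.val_mkOfDetNeZero, Matrix.vecMul_transpose,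
    LinearMap.toMatrix'_mulVec, LinearEquiv.coe_coe]

/-- The first row of `glOfEquiv θ` is `θ e₁`. [folklore] -/
private theorem glOfEquiv_apply (θ : (Fin n → F) ≃ₗ[F] (Fin n → F)) (i j : Fin n) :
    (glOfEquiv θ : Matrix (Fin n) (Fin n) F) i j = θ (Pi.single i 1) j := by
  simp only [glOfEquiv, Matrix.GeneralLinearGroup.val_mkOfDetNeZero, Matrix.transpose_apply,
    LinearMap.toMatrix'_apply, LinearEquiv.coe_coe]

end LinAlg

section Action

variable (F)
variable (s)

/-- The pairs `(P, Q) ∈ GL₂(F) × GL_s(F)`, acting by `A ↦ P A Q`. [cite: Nazarov2023FiniteFieldLB, Lemma 5] -/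
abbrev Γ := GL (Fin 2) F × GL (Fin s) F

variable {F} {s}

/-- The action `(P, Q) · A = P A Q`. [cite: Nazarov2023FiniteFieldLB, Lemma 5] -/
def act (g : Γ F s) (A : Matrix (Fin 2) (Fin s) F) : Matrix (Fin 2) (Fin s) F :=
  (g.1 : Matrix (Fin 2) (Fin 2) F) * A * (g.2 : Matrix (Fin s) (Fin s) F)

/-- Unfolding `act`. [cite: Nazarov2023FiniteFieldLB, Lemma 5] -/
theorem act_def (g : Γ F s) (A : Matrix (Fin 2) (Fin s) F) :
    act g A = (g.1 : Matrix (Fin 2) (Fin 2) F) * A * (g.2 : Matrix (Fin s) (Fin s) F) := rfl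

/-- Composition of the action. [cite: Nazarov2023FiniteFieldLB, Lemma 5] -/
theorem act_act (g h : Γ F s) (A : Matrix (Fin 2) (Fin s) F) :
    act g (act h A) = act (g.1 * h.1, h.2 * g.2) A := by
  simp only [act, Units.val_mul]
  simp only [Matrix.mul_assoc]

/-- The action of `(1, 1)`. [cite: Nazarov2023FiniteFieldLB, Lemma 5] -/
@[simp] theorem act_one (A : Matrix (Fin 2) (Fin s) F) : act (1 : Γ F s) A = A := by
  simp [act]

/-- Undoing the action. [cite: Nazarov2023FiniteFieldLB, Lemma 5] -/
theorem act_inv_act (h : Γ F s) (A : Matrix (Fin 2) (Fin s) F) : act (h.1⁻¹, h.2⁻¹) (act h A) = A := by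
  rw [act_act]
  simp only [inv_mul_cancel, mul_inv_cancel]
  exact act_one A

/-- Undoing the action. [cite: Nazarov2023FiniteFieldLB, Lemma 5] -/
theorem act_act_inv (h : Γ F s) (A : Matrix (Fin 2) (Fin s) F) : act h (act (h.1⁻¹, h.2⁻¹) A) = A := by
  rw [act_act]
  simp only [mul_inv_cancel, inv_mul_cancel]
  exact act_one A

/-- `(P A Q) v`-form: `v (P A Q) = ((v P) A) Q`. [cite: Nazarov2023FiniteFieldLB, Lemma 5] -/
theorem vecMul_act (g : Γ F s) (A : Matrix (Fin 2) (Fin s) F) (v : Fin 2 → F) :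
    Matrix.vecMul v (act g A) = Matrix.vecMul (Matrix.vecMul (Matrix.vecMul v
      (g.1 : Matrix (Fin 2) (Fin 2) F)) A) (g.2 : Matrix (Fin s) (Fin s) F) := by
  rw [act_def, Matrix.vecMul_vecMul, Matrix.vecMul_vecMul, Matrix.mul_assoc]

/-! ### The three orbits -/

/-- Rank two: the two rows are linearly independent. [cite: Nazarov2023FiniteFieldLB, Lemma 5 (matrices of rank `r = 2`)] -/
def IsRk2 (A : Matrix (Fin 2) (Fin s) F) : Prop := LinearIndependent F A.row

/-- Rank one: non-zero with dependent rows. [cite: Nazarov2023FiniteFieldLB, Lemma 5 (matrices of rank `r = 1`)] -/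
def IsRk1 (A : Matrix (Fin 2) (Fin s) F) : Prop := A ≠ 0 ∧ ¬IsRk2 A

/-- Rank two is invariant under the action. [cite: Nazarov2023FiniteFieldLB, Lemma 5 (proof)] -/
theorem isRk2_act (g : Γ F s) {A : Matrix (Fin 2) (Fin s) F} (hA : IsRk2 A) : IsRk2 (act g A) := by
  unfold IsRk2 at *
  rw [← Matrix.vecMul_injective_iff] at *
  have h1 : Function.Injective (fun v : Fin 2 → F => Matrix.vecMul v (g.1 : Matrix (Fin 2) (Fin 2) F)) :=
    Matrix.vecMul_injective_of_isUnit g.1.isUnit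
  have h2 : Function.Injective (fun v : Fin s → F => Matrix.vecMul v (g.2 : Matrix (Fin s) (Fin s) F)) :=
    Matrix.vecMul_injective_of_isUnit g.2.isUnit
  intro v w hvw
  have hvw' : Matrix.vecMul v (act g A) = Matrix.vecMul w (act g A) := hvw
  rw [vecMul_act, vecMul_act] at hvw'
  exact h1 (hA (h2 hvw'))

/-- Rank one is invariant under the action. [cite: Nazarov2023FiniteFieldLB, Lemma 5 (proof)] -/
theorem isRk1_act (g : Γ F s) {A : Matrix (Fin 2) (Fin s) F} (hA : IsRk1 A) : IsRk1 (act g A) := by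
  refine ⟨fun h0 => hA.1 ?_, fun h2 => hA.2 ?_⟩
  · rw [← act_inv_act g A, h0]
    simp [act]
  · rw [← act_inv_act g A]
    exact isRk2_act _ h2

/-- The base point of the rank-two orbit: rows `e₁, e₂`. [cite: Nazarov2023FiniteFieldLB, Lemma 5] -/
def B2 : Matrix (Fin 2) (Fin s) F :=
  Matrix.of fun i l => if l.val = i.val then 1 else 0

/-- Row `i` of `B2` is the unit vector `e_i`. [cite: Nazarov2023FiniteFieldLB, Lemma 5] -/
theorem B2_row (hs : 2 ≤ s) (i : Fin 2) :
    (B2 : Matrix (Fin 2) (Fin s) F) i = Pi.single (⟨i.val, by omega⟩ : Fin s) 1 := by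
  funext l
  simp only [B2, Matrix.of_apply, Pi.single_apply, Fin.ext_iff]

/-- Entries of `B2`. [cite: Nazarov2023FiniteFieldLB, Lemma 5] -/
theorem B2_apply (i : Fin 2) (l : Fin s) :
    (B2 : Matrix (Fin 2) (Fin s) F) i l = if l.val = i.val then 1 else 0 := rfl

/-- `B2` has rank two. [cite: Nazarov2023FiniteFieldLB, Lemma 5] -/
theorem isRk2_B2 (hs : 2 ≤ s) : IsRk2 (B2 : Matrix (Fin 2) (Fin s) F) := by
  unfold IsRk2
  rw [Matrix.row_def, Fintype.linearIndependent_iff]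
  intro c hc i
  have h := congrFun hc ⟨i.val, by omega⟩
  simp only [Finset.sum_apply, Pi.smul_apply, B2_apply, smul_eq_mul, mul_ite, mul_one, mul_zero,
    Pi.zero_apply] at h
  rw [Finset.sum_eq_single i (fun i' _ hi' => by
      rw [if_neg (fun e => hi' (Fin.ext e.symm))]) (by simp)] at h
  simpa using h

/-- **Lemma 5 (rank two)**: every rank-two matrix is `B2 · Q`. [cite: Nazarov2023FiniteFieldLB, Lemma 5] -/
theorem exists_act_B2_eq (hs : 2 ≤ s) {A : Matrix (Fin 2) (Fin s) F} (hA : IsRk2 A) :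
    ∃ g : Γ F s, act g B2 = A := by
  have hB := isRk2_B2 (F := F) hs
  unfold IsRk2 at hA hB
  rw [← Matrix.vecMul_injective_iff] at hA hB
  obtain ⟨θ, hθ⟩ := exists_equiv_comp_eq (Matrix.vecMulLinear (B2 : Matrix (Fin 2) (Fin s) F))
    (Matrix.vecMulLinear A) hB hA
  refine ⟨(1, glOfEquiv θ), ?_⟩
  ext i l
  have h := hθ (Pi.single i 1)
  simp only [Matrix.vecMulLinear_apply] at h
  have h2 := congrFun (vecMul_act ((1 : GL (Fin 2) F), glOfEquiv θ) B2 (Pi.single i 1)) l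
  rw [Units.val_one, Matrix.vecMul_one, vecMul_glOfEquiv, h, Matrix.single_one_vecMul,
    Matrix.single_one_vecMul] at h2
  exact h2

/-- The base point of the rank-one orbit: `E_{11}`. [cite: Nazarov2023FiniteFieldLB, Lemma 5] -/
def B1 (hs : 2 ≤ s) : Matrix (Fin 2) (Fin s) F := Matrix.single 0 (c0 hs) 1

/-- `E_{11}` has rank one. [cite: Nazarov2023FiniteFieldLB, Lemma 5] -/
theorem isRk1_B1 (hs : 2 ≤ s) : IsRk1 (B1 hs : Matrix (Fin 2) (Fin s) F) := by
  refine ⟨fun h => ?_, fun h => ?_⟩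
  · have := congrFun (congrFun h 0) (c0 hs)
    simp [B1] at this
  · have h1 : (B1 hs : Matrix (Fin 2) (Fin s) F).row 1 = 0 := by
      funext l
      simp [Matrix.row, B1]
    exact h.ne_zero 1 h1

/-- `(P E_{1c} Q)_{il} = P_{i1} Q_{cl}`. [folklore] -/
private theorem mul_single_mul_apply (P : Matrix (Fin 2) (Fin 2) F) (Q : Matrix (Fin s) (Fin s) F)
    (c : Fin s) (i : Fin 2) (l : Fin s) :
    (P * (Matrix.single (0 : Fin 2) c (1 : F) : Matrix (Fin 2) (Fin s) F) * Q) i l = P i 0 * Q c l := by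
  rw [Matrix.mul_assoc, Matrix.mul_apply, Finset.sum_eq_single 0 (fun k _ hk => by
      rw [Matrix.single_mul_apply_of_ne (1 : F) 0 c k l hk, mul_zero]) (by simp),
    Matrix.single_mul_apply_same, one_mul]

/-- An invertible `s × s` matrix with prescribed non-zero first row. [folklore] -/
private theorem exists_gl_row_eq (hs : 2 ≤ s) {v : Fin s → F} (hv : v ≠ 0) :
    ∃ Q : GL (Fin s) F, ∀ l, (Q : Matrix (Fin s) (Fin s) F) (c0 hs) l = v l := by
  have hinj : ∀ {w : Fin s → F}, w ≠ 0 →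
      Function.Injective (LinearMap.toSpanSingleton F (Fin s → F) w) := by
    intro w hw a b hab
    simp only [LinearMap.toSpanSingleton_apply] at hab
    have : (a - b) • w = 0 := by rw [sub_smul, hab, sub_self]
    exact sub_eq_zero.1 ((smul_eq_zero.1 this).resolve_right hw)
  have he : (Pi.single (c0 hs) (1 : F) : Fin s → F) ≠ 0 := by
    intro h
    have := congrFun h (c0 hs)
    simp at this
  obtain ⟨θ, hθ⟩ := exists_equiv_comp_eq _ _ (hinj he) (hinj hv)
  refine ⟨glOfEquiv θ, fun l => ?_⟩
  rw [glOfEquiv_apply]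
  have h1 := hθ 1
  simp only [LinearMap.toSpanSingleton_apply, one_smul] at h1
  rw [h1]

/-- **Lemma 5 (rank one)**: every rank-one matrix is `P E_{11} Q`. [cite: Nazarov2023FiniteFieldLB, Lemma 5] -/
theorem exists_act_B1_eq (hs : 2 ≤ s) {A : Matrix (Fin 2) (Fin s) F} (hA : IsRk1 A) :
    ∃ g : Γ F s, act g (B1 hs) = A := by
  obtain ⟨hA0, hdep⟩ := hA
  have hrow : A.row = ![A 0, A 1] := by
    funext i
    fin_cases i <;> rfl
  unfold IsRk2 at hdep
  rw [hrow, LinearIndependent.pair_iff] at hdep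
  simp only [not_forall, not_and] at hdep
  obtain ⟨a, b, hab, hne⟩ := hdep
  -- `A = u ⊗ v` with `v` a non-zero row and `u` explicit
  obtain ⟨u, v, hv, hP, hA'⟩ : ∃ (u : Fin 2 → F) (v : Fin s → F), v ≠ 0 ∧
      (∃ P : GL (Fin 2) F, ∀ i, (P : Matrix (Fin 2) (Fin 2) F) i 0 = u i) ∧ ∀ i, A i = u i • v := by
    by_cases h0 : A 0 = 0
    · have h1 : A 1 ≠ 0 := by
        intro h1
        apply hA0
        ext i l
        fin_cases i
        · exact congrFun h0 l
        · exact congrFun h1 l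
      refine ⟨![0, 1], A 1, h1, ⟨Matrix.GeneralLinearGroup.mkOfDetNeZero !![0, 1; 1, 0]
        (by simp [Matrix.det_fin_two]), fun i => by fin_cases i <;> simp⟩, fun i => ?_⟩
      fin_cases i
      · simp [h0]
      · simp
    · have hb : b ≠ 0 := by
        intro hb0
        rw [hb0, zero_smul, add_zero] at hab
        exact h0 ((smul_eq_zero.1 hab).resolve_left (hne · hb0))
      refine ⟨![1, -(a / b)], A 0, h0, ⟨Matrix.GeneralLinearGroup.mkOfDetNeZero !![1, 0; -(a / b), 1]
        (by simp [Matrix.det_fin_two]), fun i => by fin_cases i <;> simp⟩, fun i => ?_⟩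
      fin_cases i
      · simp
      · have : A 1 = -(a / b) • A 0 := by
          have e : b • A 1 = -(a • A 0) := eq_neg_of_add_eq_zero_right hab
          have := congrArg (fun x => b⁻¹ • x) e
          simp only [smul_smul, inv_mul_cancel₀ hb, one_smul, smul_neg] at this
          rw [this, neg_smul, div_eq_inv_mul]
        simpa using this
  obtain ⟨P, hPu⟩ := hP
  obtain ⟨Q, hQ⟩ := exists_gl_row_eq hs hv
  refine ⟨(P, Q), ?_⟩
  ext i l
  rw [act_def, B1, mul_single_mul_apply, hPu, hQ, hA' i]
  rfl

end Action

/-! ## Lemmas 3 and 5: counting over `GL₂(F) × GL_s(F)` -/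

section Counting

variable [Fintype F] [DecidableEq F]

/-- Rank two is decidable (classically). [cite: Nazarov2023FiniteFieldLB, Lemma 5] -/
noncomputable instance : DecidablePred (IsRk2 (F := F) (s := s)) := Classical.decPred _

/-- Rank one is decidable (classically). [cite: Nazarov2023FiniteFieldLB, Lemma 5] -/
noncomputable instance : DecidablePred (IsRk1 (F := F) (s := s)) := Classical.decPred _

/-- `N(A, C) = #{(P, Q) : P A Q = C}`. [cite: Nazarov2023FiniteFieldLB, Lemma 5 (2)] -/
noncomputable def cnt (A C : Matrix (Fin 2) (Fin s) F) : ℕ :=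
  (Finset.univ.filter fun g : Γ F s => act g A = C).card

/-- `N(P₀ A Q₀, C) = N(A, C)`. [cite: Nazarov2023FiniteFieldLB, Lemma 5 (proof)] -/
theorem cnt_act_left (h : Γ F s) (A C : Matrix (Fin 2) (Fin s) F) : cnt (act h A) C = cnt A C := by
  unfold cnt
  refine Finset.card_equiv ((Equiv.mulRight h.1).prodCongr (Equiv.mulLeft h.2)) fun g => ?_
  simp only [Finset.mem_filter, Finset.mem_univ, true_and, Equiv.prodCongr_apply,
    Equiv.coe_mulRight, Equiv.coe_mulLeft, Prod.map, act_act]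

/-- `N(A, P₀ C Q₀) = N(A, C)`. [cite: Nazarov2023FiniteFieldLB, Lemma 5 (proof)] -/
theorem cnt_act_right (h : Γ F s) (A C : Matrix (Fin 2) (Fin s) F) : cnt A (act h C) = cnt A C := by
  unfold cnt
  refine Finset.card_equiv ((Equiv.mulLeft h.1⁻¹).prodCongr (Equiv.mulRight h.2⁻¹)) fun g => ?_
  simp only [Finset.mem_filter, Finset.mem_univ, true_and, Equiv.prodCongr_apply,
    Equiv.coe_mulRight, Equiv.coe_mulLeft, Prod.map]
  have e : act (h.1⁻¹ * g.1, g.2 * h.2⁻¹) A = act (h.1⁻¹, h.2⁻¹) (act g A) := by rw [act_act]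
  rw [e]
  constructor
  · intro hg
    rw [hg, act_inv_act]
  · intro hg
    rw [← act_act_inv h (act g A), hg]

/-- `∑_C N(A, C) = |G|`. [cite: Nazarov2023FiniteFieldLB, Lemma 5 (proof)] -/
theorem sum_cnt (A : Matrix (Fin 2) (Fin s) F) : ∑ C, cnt A C = Fintype.card (Γ F s) := by
  unfold cnt
  rw [← Finset.card_univ, Finset.card_eq_sum_card_fiberwise (f := fun g : Γ F s => act g A)
    (t := Finset.univ) (fun g _ => Finset.mem_coe.2 (Finset.mem_univ _))]

/-- **Lemma 5 (1)**: `N(A, C)` depends only on the orbits. [cite: Nazarov2023FiniteFieldLB, Lemma 5 (1)] -/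
theorem cnt_eq_of_orbit {p : Matrix (Fin 2) (Fin s) F → Prop} {B : Matrix (Fin 2) (Fin s) F}
    (htrans : ∀ A, p A → ∃ g : Γ F s, act g B = A) {A C : Matrix (Fin 2) (Fin s) F} (hA : p A)
    (hC : p C) : cnt A C = cnt B B := by
  obtain ⟨g, rfl⟩ := htrans A hA
  obtain ⟨h, rfl⟩ := htrans C hC
  rw [cnt_act_left, cnt_act_right]

/-- **Lemma 5 (2)**: `R_r · N_r = |G|`. [cite: Nazarov2023FiniteFieldLB, Lemma 5 (2)] -/
theorem card_mul_cnt {p : Matrix (Fin 2) (Fin s) F → Prop} [DecidablePred p]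
    {B : Matrix (Fin 2) (Fin s) F} (hB : p B) (hpB : ∀ g : Γ F s, p (act g B))
    (htrans : ∀ A, p A → ∃ g : Γ F s, act g B = A) :
    (Finset.univ.filter p).card * cnt B B = Fintype.card (Γ F s) := by
  rw [← sum_cnt B, ← Finset.sum_filter_add_sum_filter_not Finset.univ p]
  have h0 : ∑ C ∈ Finset.univ.filter (fun C => ¬p C), cnt B C = 0 := by
    refine Finset.sum_eq_zero fun C hC => ?_
    have hC' := (Finset.mem_filter.1 hC).2
    unfold cnt
    rw [Finset.card_eq_zero, Finset.filter_eq_empty_iff]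
    intro g _ hg
    exact hC' (hg ▸ hpB g)
  rw [h0, add_zero, Finset.sum_congr rfl (fun C hC =>
    (cnt_eq_of_orbit htrans hB (Finset.mem_filter.1 hC).2 : cnt B C = cnt B B)),
    Finset.sum_const, smul_eq_mul]

/-- Double counting: `∑_{(P,Q)} #{t : P A_t Q ∈ L} = ∑_t #{(P,Q) : P A_t Q ∈ L}`. [cite: Nazarov2023FiniteFieldLB, Lemma 3 (proof)] -/
private theorem sum_card_comm (As : ι → Matrix (Fin 2) (Fin s) F) (q : Matrix (Fin 2) (Fin s) F → Prop)
    [DecidablePred q] :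
    ∑ g : Γ F s, (Finset.univ.filter fun t : ι => q (act g (As t))).card =
      ∑ t : ι, (Finset.univ.filter fun g : Γ F s => q (act g (As t))).card := by
  simp only [Finset.card_filter]
  exact Finset.sum_comm

/-- Pigeonhole: some `(P, Q)` does at least average ("найдется подпространство типа ∗, которому
принадлежат не менее … матриц"). [cite: Nazarov2023FiniteFieldLB, Lemma 3] -/
private theorem exists_good (As : ι → Matrix (Fin 2) (Fin s) F) (q : Matrix (Fin 2) (Fin s) F → Prop)
    [DecidablePred q] :
    ∃ g : Γ F s, ∑ t : ι, (Finset.univ.filter fun g' : Γ F s => q (act g' (As t))).card ≤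
      (Finset.univ.filter fun t : ι => q (act g (As t))).card * Fintype.card (Γ F s) := by
  obtain ⟨g, -, hg⟩ := Finset.exists_le_of_sum_le (s := (Finset.univ : Finset (Γ F s)))
    (f := fun _ => ∑ t : ι, (Finset.univ.filter fun g' : Γ F s => q (act g' (As t))).card)
    (g := fun g => (Finset.univ.filter fun t : ι => q (act g (As t))).card * Fintype.card (Γ F s))
    Finset.univ_nonempty (le_of_eq (by
      rw [Finset.sum_const, smul_eq_mul, ← Finset.sum_mul, sum_card_comm, Finset.card_univ,
        mul_comm]))
  exact ⟨g, hg⟩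

/-- `#{(P,Q) : P A Q ∈ L} = ∑_{C ∈ L} N(A, C)`. [cite: Nazarov2023FiniteFieldLB, Lemma 3 (proof)] -/
private theorem card_eq_sum_cnt (q : Matrix (Fin 2) (Fin s) F → Prop) [DecidablePred q]
    (A : Matrix (Fin 2) (Fin s) F) :
    (Finset.univ.filter fun g : Γ F s => q (act g A)).card = ∑ C ∈ Finset.univ.filter q, cnt A C := by
  unfold cnt
  rw [Finset.card_eq_sum_card_fiberwise (f := fun g : Γ F s => act g A) (t := Finset.univ.filter q)
    (fun g hg => by simpa using hg)]
  refine Finset.sum_congr rfl fun C hC => ?_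
  congr 1
  ext g
  simp only [Finset.mem_filter, Finset.mem_univ, true_and]
  exact ⟨fun h => h.2, fun h => ⟨by rw [h]; exact (Finset.mem_filter.1 hC).2, h⟩⟩

/-- For `A` in the orbit of `B`: `#{(P,Q) : P A Q ∈ L} ≥ #(L ∩ orbit) · N(B, B)`.
[cite: Nazarov2023FiniteFieldLB, Lemma 3 (proof)] -/
private theorem card_mul_cnt_le (q p : Matrix (Fin 2) (Fin s) F → Prop) [DecidablePred q] [DecidablePred p]
    {B : Matrix (Fin 2) (Fin s) F} (htrans : ∀ A, p A → ∃ g : Γ F s, act g B = A)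
    {A : Matrix (Fin 2) (Fin s) F} (hA : p A) :
    (Finset.univ.filter fun C => q C ∧ p C).card * cnt B B ≤
      (Finset.univ.filter fun g : Γ F s => q (act g A)).card := by
  rw [card_eq_sum_cnt]
  calc (Finset.univ.filter fun C => q C ∧ p C).card * cnt B B
      = ∑ C ∈ Finset.univ.filter (fun C => q C ∧ p C), cnt A C := by
        rw [Finset.sum_congr rfl (fun C hC =>
          cnt_eq_of_orbit htrans hA (Finset.mem_filter.1 hC).2.2), Finset.sum_const, smul_eq_mul]
    _ ≤ ∑ C ∈ Finset.univ.filter q, cnt A C :=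
        Finset.sum_le_sum_of_subset fun C hC => by
          simp only [Finset.mem_filter, Finset.mem_univ, true_and] at hC ⊢
          exact hC.1

end Counting

/-! ## The subspaces `L*` and `L@` and their elements by rank (Lemma 2 for `n = 2`) -/

section Subspaces

variable (hs : 2 ≤ s)

/-- `C ∈ L*` (spanned by `E_{1j}`, `j < s`, and `E_{1s} − E_{21}`): the forms vanishing under the
substitution of Lemma 7. [cite: Nazarov2023FiniteFieldLB, §3 (the subspace `L*`)] -/
def IsTS (C : Matrix (Fin 2) (Fin s) F) : Prop :=
  (fun c => C 1 c + if c = c0 hs then C 0 (cl hs) else 0) = 0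

/-- `C ∈ L@` (spanned by `E_{21}` and `E_{1c} − E_{2,c+1}`): the forms vanishing under the substitution
of Lemma 8. [cite: Nazarov2023FiniteFieldLB, §3 (the subspace `L@`)] -/
def IsTA (C : Matrix (Fin 2) (Fin s) F) : Prop :=
  (fun c : Fin s => C 0 c + if h : c.val + 1 < s then C 1 ⟨c.val + 1, h⟩ else 0) = 0

omit [Fintype ι] in
/-- A non-zero `2 × 2` minor forces rank two. [folklore] -/
private theorem isRk2_of_minor {C : Matrix (Fin 2) (Fin s) F} (c c' : Fin s)
    (h : C 0 c * C 1 c' - C 0 c' * C 1 c ≠ 0) : IsRk2 C := by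
  unfold IsRk2
  have hrow : C.row = ![C 0, C 1] := by
    funext i
    fin_cases i <;> rfl
  rw [hrow, LinearIndependent.pair_iff]
  intro x y hxy
  have h1 := congrFun hxy c
  have h2 := congrFun hxy c'
  simp only [Pi.add_apply, Pi.smul_apply, smul_eq_mul, Pi.zero_apply] at h1 h2
  have hx : x * (C 0 c * C 1 c' - C 0 c' * C 1 c) = 0 := by linear_combination C 1 c' * h1 - C 1 c * h2
  have hy : y * (C 0 c * C 1 c' - C 0 c' * C 1 c) = 0 := by linear_combination (-C 0 c') * h1 + C 0 c * h2
  exact ⟨(mul_eq_zero.1 hx).resolve_right h, (mul_eq_zero.1 hy).resolve_right h⟩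

omit [Fintype ι] in
/-- A zero row forces rank `< 2`. [folklore] -/
private theorem not_isRk2_of_row_eq_zero {C : Matrix (Fin 2) (Fin s) F} (i : Fin 2) (h : C i = 0) : ¬IsRk2 C :=
  fun hC => hC.ne_zero i h

/-- The element of `L*` with first row `r`. [cite: Nazarov2023FiniteFieldLB, §3 (the subspace `L*`)] -/
def mkS (r : Fin s → F) : Matrix (Fin 2) (Fin s) F :=
  Matrix.of ![r, fun c => if c = c0 hs then -r (cl hs) else 0]

omit [Fintype ι] in
/-- Entries of `mkS`. [cite: Nazarov2023FiniteFieldLB, §3] -/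
@[simp] theorem mkS_zero (r : Fin s → F) (c : Fin s) : mkS hs r 0 c = r c := rfl

omit [Fintype ι] in
/-- Entries of `mkS`. [cite: Nazarov2023FiniteFieldLB, §3] -/
@[simp] theorem mkS_one (r : Fin s → F) (c : Fin s) :
    mkS hs r 1 c = if c = c0 hs then -r (cl hs) else 0 := rfl

omit [Fintype ι] in
/-- `L*` consists of the `mkS r`. [cite: Nazarov2023FiniteFieldLB, §3] -/
theorem isTS_iff (C : Matrix (Fin 2) (Fin s) F) : IsTS hs C ↔ C = mkS hs (C 0) := by
  constructor
  · intro h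
    ext i c
    fin_cases i
    · rfl
    · have hc := congrFun h c
      simp only [Pi.zero_apply] at hc
      show C 1 c = mkS hs (C 0) 1 c
      rw [mkS_one]
      by_cases hcc : c = c0 hs
      · rw [if_pos hcc] at hc ⊢
        linear_combination hc
      · rw [if_neg hcc] at hc ⊢
        simpa using hc
  · intro h
    rw [h]
    funext c
    simp only [mkS_one, mkS_zero, Pi.zero_apply]
    by_cases hcc : c = c0 hs
    · simp [hcc]
    · simp [hcc]

omit [Fintype ι] in
/-- Rank two in `L*`: `r_s ≠ 0`. [cite: Nazarov2023FiniteFieldLB, §3 (`v*₂ = K^s − K^{s−1}`)] -/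
theorem isRk2_mkS_iff (r : Fin s → F) : IsRk2 (mkS hs r) ↔ r (cl hs) ≠ 0 := by
  constructor
  · intro h hr
    refine not_isRk2_of_row_eq_zero 1 ?_ h
    funext c
    simp [hr]
  · intro hr
    refine isRk2_of_minor (c0 hs) (cl hs) ?_
    simp only [mkS_zero, mkS_one, if_true, if_neg (c0_ne_cl hs).symm]
    rw [mul_zero, zero_sub, mul_neg, neg_neg]
    exact mul_ne_zero hr hr

omit [Fintype ι] in
/-- Rank one in `L*`: `r ≠ 0`, `r_s = 0`. [cite: Nazarov2023FiniteFieldLB, §3 (`v*₁ = K^{s−1} − 1`)] -/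
theorem isRk1_mkS_iff (r : Fin s → F) : IsRk1 (mkS hs r) ↔ r ≠ 0 ∧ r (cl hs) = 0 := by
  unfold IsRk1
  rw [isRk2_mkS_iff, not_not]
  refine and_congr_left fun hr => ?_
  constructor
  · intro h h0
    apply h
    ext i c
    fin_cases i
    · simp [h0]
    · simp [h0]
  · intro h h0
    apply h
    funext c
    exact congrFun (congrFun h0 0) c

/-- The element of `L@` with second row `r`. [cite: Nazarov2023FiniteFieldLB, §3 (the subspace `L@`)] -/
def mkA (r : Fin s → F) : Matrix (Fin 2) (Fin s) F :=
  Matrix.of ![fun c => if h : c.val + 1 < s then -r ⟨c.val + 1, h⟩ else 0, r]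

omit [Fintype ι] in
/-- Entries of `mkA`. [cite: Nazarov2023FiniteFieldLB, §3] -/
@[simp] theorem mkA_zero (r : Fin s → F) (c : Fin s) :
    mkA r 0 c = if h : c.val + 1 < s then -r ⟨c.val + 1, h⟩ else 0 := rfl

omit [Fintype ι] in
/-- Entries of `mkA`. [cite: Nazarov2023FiniteFieldLB, §3] -/
@[simp] theorem mkA_one (r : Fin s → F) (c : Fin s) : mkA r 1 c = r c := rfl

omit [Fintype ι] in
/-- `L@` consists of the `mkA r`. [cite: Nazarov2023FiniteFieldLB, §3] -/
theorem isTA_iff (C : Matrix (Fin 2) (Fin s) F) : IsTA C ↔ C = mkA (C 1) := by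
  constructor
  · intro h
    ext i c
    fin_cases i
    · have hc := congrFun h c
      simp only [Pi.zero_apply] at hc
      show C 0 c = mkA (C 1) 0 c
      rw [mkA_zero]
      by_cases hcc : c.val + 1 < s
      · rw [dif_pos hcc] at hc ⊢
        linear_combination hc
      · rw [dif_neg hcc] at hc ⊢
        simpa using hc
    · rfl
  · intro h
    rw [h]
    funext c
    simp only [mkA_one, mkA_zero, Pi.zero_apply]
    by_cases hcc : c.val + 1 < s
    · simp [hcc]
    · simp [hcc]

omit [Fintype ι] in
/-- Rank two in `L@`: some `r_c ≠ 0`, `c ≥ 2`. [cite: Nazarov2023FiniteFieldLB, §3 (`v@₂ = K^s − K`)] -/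
theorem isRk2_mkA_iff (r : Fin s → F) : IsRk2 (mkA r) ↔ ∃ c, c ≠ c0 hs ∧ r c ≠ 0 := by
  classical
  constructor
  · intro h
    by_contra hne
    simp only [not_exists, not_and, not_not] at hne
    refine not_isRk2_of_row_eq_zero 0 ?_ h
    funext c
    simp only [mkA_zero, Pi.zero_apply]
    by_cases hcc : c.val + 1 < s
    · rw [dif_pos hcc, hne _ (fun e => by have := Fin.ext_iff.1 e; simp [c0] at this), neg_zero]
    · rw [dif_neg hcc]
  · rintro ⟨c, hc, hrc⟩
    -- the largest index `k ≠ 0` with `r_k ≠ 0`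
    let T : Finset (Fin s) := Finset.univ.filter fun c => c ≠ c0 hs ∧ r c ≠ 0
    have hT : T.Nonempty := ⟨c, by simp [T, hc, hrc]⟩
    let k := T.max' hT
    have hk : k ∈ T := Finset.max'_mem T hT
    simp only [T, Finset.mem_filter, Finset.mem_univ, true_and] at hk
    have hk1 : 1 ≤ k.val := by
      rcases Nat.eq_zero_or_pos k.val with h0 | h0
      · exact absurd (Fin.ext (by simp [c0, h0])) hk.1
      · exact h0
    have hnext : ∀ h : k.val + 1 < s, r ⟨k.val + 1, h⟩ = 0 := by
      intro h
      by_contra hne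
      have hmem : (⟨k.val + 1, h⟩ : Fin s) ∈ T := by
        simp only [T, Finset.mem_filter, Finset.mem_univ, true_and]
        exact ⟨fun e => by have := Fin.ext_iff.1 e; simp [c0] at this, hne⟩
      have := Finset.le_max' T _ hmem
      rw [Fin.le_iff_val_le_val] at this
      simp at this
      omega
    refine isRk2_of_minor ⟨k.val - 1, by omega⟩ k ?_
    have e1 : mkA r 0 ⟨k.val - 1, by omega⟩ = -r k := by
      rw [mkA_zero, dif_pos (by simp; omega)]
      congr 2
      exact Fin.ext (by simp; omega)
    have e2 : mkA r 0 k = 0 := by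
      rw [mkA_zero]
      by_cases h : k.val + 1 < s
      · rw [dif_pos h, hnext h, neg_zero]
      · rw [dif_neg h]
    rw [e1, e2, mkA_one, zero_mul, sub_zero, neg_mul]
    exact neg_ne_zero.2 (mul_ne_zero hk.2 hk.2)

omit [Fintype ι] in
/-- Rank one in `L@`: `r = r₁ e₁`, `r₁ ≠ 0`. [cite: Nazarov2023FiniteFieldLB, §3 (`v@₁ = K − 1`)] -/
theorem isRk1_mkA_iff (r : Fin s → F) :
    IsRk1 (mkA r) ↔ (∀ c, c ≠ c0 hs → r c = 0) ∧ r (c0 hs) ≠ 0 := by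
  classical
  unfold IsRk1
  rw [isRk2_mkA_iff hs]
  simp only [not_exists, not_and, not_not]
  rw [and_comm]
  refine and_congr_right fun hz => ?_
  constructor
  · intro h h0
    apply h
    have hr : r = 0 := by
      funext c
      by_cases hc : c = c0 hs
      · rw [hc, h0]; rfl
      · exact hz c hc
    ext i c
    fin_cases i
    · show mkA r 0 c = 0
      rw [mkA_zero]
      by_cases hcc : c.val + 1 < s
      · rw [dif_pos hcc, hr, Pi.zero_apply, neg_zero]
      · rw [dif_neg hcc]
    · show mkA r 1 c = 0
      simp [hr]
  · intro h h0
    exact h (congrFun (congrFun h0 1) (c0 hs))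

end Subspaces

/-! ### The numbers `v*_r`, `v@_r`, `R_r` -/

section Numbers

variable [Fintype F] [DecidableEq F]

/-- Membership in `L*` is decidable. [cite: Nazarov2023FiniteFieldLB, §3] -/
instance (hs : 2 ≤ s) (C : Matrix (Fin 2) (Fin s) F) : Decidable (IsTS hs C) :=
  inferInstanceAs (Decidable (_ = _))

/-- Membership in `L@` is decidable. [cite: Nazarov2023FiniteFieldLB, §3] -/
instance (C : Matrix (Fin 2) (Fin s) F) : Decidable (IsTA C) := inferInstanceAs (Decidable (_ = _))

/-- Counting a parametrised family: `#{y : T y ∧ p y} = #{x : p (mk x)}`. [folklore] -/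
private theorem card_filter_param {X Y : Type*} [Fintype X] [Fintype Y] [DecidableEq Y] (mk : X → Y)
    (proj : Y → X) (hproj : ∀ x, proj (mk x) = x) (T : Y → Prop) [DecidablePred T]
    (hT : ∀ y, T y ↔ y = mk (proj y)) (p : Y → Prop) [DecidablePred p] (p' : X → Prop)
    [DecidablePred p'] (hp : ∀ x, p (mk x) ↔ p' x) :
    (Finset.univ.filter fun y => T y ∧ p y).card = (Finset.univ.filter p').card := by
  have h : (Finset.univ.filter fun y => T y ∧ p y) = (Finset.univ.filter p').image mk := by
    ext y
    simp only [Finset.mem_filter, Finset.mem_univ, true_and, Finset.mem_image]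
    constructor
    · rintro ⟨hy, hpy⟩
      refine ⟨proj y, ?_, ((hT y).1 hy).symm⟩
      rw [← hp, ← (hT y).1 hy]
      exact hpy
    · rintro ⟨x, hx, rfl⟩
      exact ⟨(hT _).2 (by rw [hproj]), (hp x).2 hx⟩
  rw [h, Finset.card_image_of_injective _ (fun x x' hxx' => by
    rw [← hproj x, ← hproj x', hxx'])]

omit [Field F] [DecidableEq F] in
/-- `|F^s| = K^s`. [folklore] -/
private theorem card_vec : Fintype.card (Fin s → F) = Fintype.card F ^ s := by
  rw [Fintype.card_fun, Fintype.card_fin]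

/-- `#{r ∈ F^s : r_c = 0} = K^{s−1}`. [folklore] -/
private theorem card_coord_eq_zero (c : Fin s) :
    (Finset.univ.filter fun r : Fin s → F => r c = 0).card = Fintype.card F ^ (s - 1) := by
  have h := Fintype.card_filter_piFinset_const_eq_of_mem (Finset.univ : Finset F) c
    (Finset.mem_univ (0 : F))
  rw [Fintype.piFinset_univ, Finset.card_univ, Fintype.card_fin] at h
  exact h

/-- `#{r ∈ F^s : r_c ≠ 0} = K^s − K^{s−1}`. [folklore] -/
private theorem card_coord_ne_zero (c : Fin s) :
    (Finset.univ.filter fun r : Fin s → F => r c ≠ 0).card = Fintype.card F ^ s - Fintype.card F ^ (s - 1) := by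
  have h := Finset.card_filter_add_card_filter_not (s := (Finset.univ : Finset (Fin s → F)))
    (fun r => r c = 0)
  rw [Finset.card_univ, card_vec, card_coord_eq_zero] at h
  have e : (Finset.univ.filter fun r : Fin s → F => r c ≠ 0) =
      Finset.univ.filter fun r : Fin s → F => ¬r c = 0 := rfl
  rw [e]
  omega

/-- `#{r ∈ F^s : r supported on the first coordinate} = K`. [folklore] -/
private theorem card_supp_first (hs : 2 ≤ s) :
    (Finset.univ.filter fun r : Fin s → F => ∀ c, c ≠ c0 hs → r c = 0).card = Fintype.card F := by
  have h : (Finset.univ.filter fun r : Fin s → F => ∀ c, c ≠ c0 hs → r c = 0) =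
      (Finset.univ : Finset F).image fun a => Pi.single (c0 hs) a := by
    ext r
    simp only [Finset.mem_filter, Finset.mem_univ, true_and, Finset.mem_image]
    constructor
    · intro hr
      refine ⟨r (c0 hs), ?_⟩
      funext c
      by_cases hc : c = c0 hs
      · rw [hc, Pi.single_eq_same]
      · rw [Pi.single_eq_of_ne hc, hr c hc]
    · rintro ⟨a, rfl⟩ c hc
      exact Pi.single_eq_of_ne (M := fun _ : Fin s => F) hc a
  rw [h, Finset.card_image_of_injective _ (Pi.single_injective (M := fun _ : Fin s => F) (c0 hs)),
    Finset.card_univ]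

/-- `v@₂`: `#{r : some r_c ≠ 0, c ≥ 2} = K^s − K`. [cite: Nazarov2023FiniteFieldLB, §3 (`v@₂ = K^s − K`)] -/
private theorem card_exists_ne_zero (hs : 2 ≤ s) :
    (Finset.univ.filter fun r : Fin s → F => ∃ c, c ≠ c0 hs ∧ r c ≠ 0).card =
      Fintype.card F ^ s - Fintype.card F := by
  have h := Finset.card_filter_add_card_filter_not (s := (Finset.univ : Finset (Fin s → F)))
    (fun r => ∀ c, c ≠ c0 hs → r c = 0)
  rw [Finset.card_univ, card_vec, card_supp_first] at h
  have e : (Finset.univ.filter fun r : Fin s → F => ¬∀ c, c ≠ c0 hs → r c = 0) =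
      Finset.univ.filter fun r : Fin s → F => ∃ c, c ≠ c0 hs ∧ r c ≠ 0 := by
    ext r
    simp only [Finset.mem_filter, Finset.mem_univ, true_and, not_forall, exists_prop]
  rw [e] at h
  omega

/-- `v@₁`: `#{r = r₁ e₁, r₁ ≠ 0} = K − 1`. [cite: Nazarov2023FiniteFieldLB, §3 (`v@₁ = K − 1`)] -/
private theorem card_supp_first_ne_zero (hs : 2 ≤ s) :
    (Finset.univ.filter fun r : Fin s → F => (∀ c, c ≠ c0 hs → r c = 0) ∧ r (c0 hs) ≠ 0).card =
      Fintype.card F - 1 := by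
  have h : (Finset.univ.filter fun r : Fin s → F => (∀ c, c ≠ c0 hs → r c = 0) ∧ r (c0 hs) ≠ 0) =
      (Finset.univ.filter fun r : Fin s → F => ∀ c, c ≠ c0 hs → r c = 0).erase 0 := by
    ext r
    simp only [Finset.mem_filter, Finset.mem_univ, true_and, Finset.mem_erase]
    constructor
    · rintro ⟨h1, h2⟩
      exact ⟨fun h0 => h2 (by rw [h0]; rfl), h1⟩
    · rintro ⟨h0, h1⟩
      refine ⟨h1, fun h2 => h0 ?_⟩
      funext c
      by_cases hc : c = c0 hs
      · rw [hc, h2]; rfl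
      · exact h1 c hc
  rw [h, Finset.card_erase_of_mem (by simp), card_supp_first]

/-- `v*₁`: `#{r ≠ 0 : r_s = 0} = K^{s−1} − 1`. [cite: Nazarov2023FiniteFieldLB, §3 (`v*₁ = K^{s−1} − 1`)] -/
private theorem card_ne_zero_coord_eq_zero (hs : 2 ≤ s) :
    (Finset.univ.filter fun r : Fin s → F => r ≠ 0 ∧ r (cl hs) = 0).card = Fintype.card F ^ (s - 1) - 1 := by
  have h : (Finset.univ.filter fun r : Fin s → F => r ≠ 0 ∧ r (cl hs) = 0) =
      (Finset.univ.filter fun r : Fin s → F => r (cl hs) = 0).erase 0 := by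
    ext r
    simp only [Finset.mem_filter, Finset.mem_univ, true_and, Finset.mem_erase]
  rw [h, Finset.card_erase_of_mem (by simp), card_coord_eq_zero]

/-- The rank-two elements of `L*`: `K^s − K^{s−1}` of them. [cite: Nazarov2023FiniteFieldLB, §3 (`v*₂`)] -/
theorem card_TS_rk2 (hs : 2 ≤ s) : (Finset.univ.filter fun C : Matrix (Fin 2) (Fin s) F => IsTS hs C ∧ IsRk2 C).card =
    Fintype.card F ^ s - Fintype.card F ^ (s - 1) := by
  rw [card_filter_param (mkS hs) (fun C => C 0) (fun r => rfl) (IsTS hs) (isTS_iff hs) IsRk2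
    (fun r => r (cl hs) ≠ 0) (isRk2_mkS_iff hs), card_coord_ne_zero]

/-- The rank-one elements of `L*`: `K^{s−1} − 1` of them. [cite: Nazarov2023FiniteFieldLB, §3 (`v*₁`)] -/
theorem card_TS_rk1 (hs : 2 ≤ s) : (Finset.univ.filter fun C : Matrix (Fin 2) (Fin s) F => IsTS hs C ∧ IsRk1 C).card =
    Fintype.card F ^ (s - 1) - 1 := by
  rw [card_filter_param (mkS hs) (fun C => C 0) (fun r => rfl) (IsTS hs) (isTS_iff hs) IsRk1
    (fun r => r ≠ 0 ∧ r (cl hs) = 0) (isRk1_mkS_iff hs), card_ne_zero_coord_eq_zero]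

/-- The rank-two elements of `L@`: `K^s − K` of them. [cite: Nazarov2023FiniteFieldLB, §3 (`v@₂`)] -/
theorem card_TA_rk2 (hs : 2 ≤ s) : (Finset.univ.filter fun C : Matrix (Fin 2) (Fin s) F => IsTA C ∧ IsRk2 C).card =
    Fintype.card F ^ s - Fintype.card F := by
  rw [card_filter_param mkA (fun C => C 1) (fun r => rfl) IsTA isTA_iff IsRk2
    (fun r => ∃ c, c ≠ c0 hs ∧ r c ≠ 0) (isRk2_mkA_iff hs), card_exists_ne_zero]

/-- The rank-one elements of `L@`: `K − 1` of them. [cite: Nazarov2023FiniteFieldLB, §3 (`v@₁`)] -/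
theorem card_TA_rk1 (hs : 2 ≤ s) : (Finset.univ.filter fun C : Matrix (Fin 2) (Fin s) F => IsTA C ∧ IsRk1 C).card =
    Fintype.card F - 1 := by
  rw [card_filter_param mkA (fun C => C 1) (fun r => rfl) IsTA isTA_iff IsRk1
    (fun r => (∀ c, c ≠ c0 hs → r c = 0) ∧ r (c0 hs) ≠ 0) (isRk1_mkA_iff hs), card_supp_first_ne_zero]

omit [DecidableEq F] in
/-- `R₂ = (K^s − 1)(K^s − K)`: pairs of independent rows. [cite: Nazarov2023FiniteFieldLB, Lemma 1 (`r = n = 2`)] -/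
theorem card_rk2 (hs : 2 ≤ s) : (Finset.univ.filter (IsRk2 (F := F) (s := s))).card =
    (Fintype.card F ^ s - 1) * (Fintype.card F ^ s - Fintype.card F) := by
  have h := card_linearIndependent (K := F) (V := Fin s → F) (k := 2)
    (by rw [Module.finrank_fin_fun]; exact hs)
  rw [Module.finrank_fin_fun, Fin.prod_univ_two] at h
  simp only [Fin.val_zero, pow_zero, Fin.val_one, pow_one] at h
  rw [← Fintype.card_subtype, ← Nat.card_eq_fintype_card]
  exact h

/-- `1 + R₁ + R₂ = K^{2s}`. [cite: Nazarov2023FiniteFieldLB, Lemma 1] -/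
theorem card_orbits : 1 + (Finset.univ.filter (IsRk1 (F := F) (s := s))).card +
    (Finset.univ.filter (IsRk2 (F := F) (s := s))).card = (Fintype.card F ^ s) ^ 2 := by
  have hM : Fintype.card (Matrix (Fin 2) (Fin s) F) = (Fintype.card F ^ s) ^ 2 := by
    rw [show Fintype.card (Matrix (Fin 2) (Fin s) F) = Fintype.card (Fin 2 → Fin s → F) from rfl,
      Fintype.card_fun, Fintype.card_fin, card_vec]
  rw [← hM, ← Finset.card_univ, ← Finset.card_filter_add_card_filter_not
    (s := (Finset.univ : Finset (Matrix (Fin 2) (Fin s) F))) IsRk2, ← Finset.card_filter_add_card_filter_not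
    (s := Finset.univ.filter fun A : Matrix (Fin 2) (Fin s) F => ¬IsRk2 A) (fun A => A = 0)]
  have h0 : ((Finset.univ.filter fun A : Matrix (Fin 2) (Fin s) F => ¬IsRk2 A).filter
      fun A => A = 0) = {0} := by
    ext A
    simp only [Finset.mem_filter, Finset.mem_univ, true_and, Finset.mem_singleton]
    constructor
    · exact fun h => h.2
    · rintro rfl
      exact ⟨not_isRk2_of_row_eq_zero 0 rfl, rfl⟩
  have h1 : ((Finset.univ.filter fun A : Matrix (Fin 2) (Fin s) F => ¬IsRk2 A).filter
      fun A => ¬A = 0) = Finset.univ.filter (IsRk1 (F := F) (s := s)) := by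
    ext A
    simp only [Finset.mem_filter, Finset.mem_univ, true_and, IsRk1]
    tauto
  rw [h0, h1, Finset.card_singleton]
  omega

end Numbers

/-! ## Lemma 6: change of coordinates `A_t ↦ P A_t Q` -/

section Twist

variable (β : BilinComp (mulBilin F 2 s m) ι)

/-- **Lemma 6** (= Lemma 5 of Alekseev–Nazarov 2019): the computation with `f'_t(x) = f_t(Pᵀ x Qᵀ)`,
`g'_t(y) = g_t((Qᵀ)⁻¹ y)`, `w'_t = (Pᵀ)⁻¹ w_t`; its coefficient matrices are `P A_t Q`.
[cite: Nazarov2023FiniteFieldLB, Lemma 6] -/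
noncomputable def twist (P : Matrix (Fin 2) (Fin 2) F) (Q : Matrix (Fin s) (Fin s) F) (hP : IsUnit P.det)
    (hQ : IsUnit Q.det) : BilinComp (mulBilin F 2 s m) ι :=
  β.comap ((mulLeftLin F P.transpose).comp (mulRightLin F Q.transpose)) (mulLeftLin F (Q.transpose)⁻¹)
    (mulLeftLin F (P.transpose)⁻¹)
    (fun x y => by
      have hP' : IsUnit (Matrix.transpose P).det := Matrix.isUnit_det_transpose P hP
      have hQ' : IsUnit (Matrix.transpose Q).det := Matrix.isUnit_det_transpose Q hQ
      simp only [LinearMap.comp_apply, mulLeftLin_apply, mulRightLin_apply, mulBilin_apply]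
      rw [Matrix.mul_assoc P.transpose (x * Q.transpose), Matrix.mul_assoc x Q.transpose,
        ← Matrix.mul_assoc Q.transpose, Matrix.mul_nonsing_inv _ hQ', Matrix.one_mul,
        ← Matrix.mul_assoc (P.transpose)⁻¹, Matrix.nonsing_inv_mul _ hP', Matrix.one_mul])

/-- The coefficient matrices of the twisted computation are `P A_t Q`. [cite: Nazarov2023FiniteFieldLB, Lemma 6] -/
theorem A_twist (P : Matrix (Fin 2) (Fin 2) F) (Q : Matrix (Fin s) (Fin s) F) (hP : IsUnit P.det)
    (hQ : IsUnit Q.det) (t : ι) : A (twist β P Q hP hQ) t = P * A β t * Q := by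
  ext i l
  rw [A_apply, twist, BilinComp.comap_f, LinearMap.comp_apply, mulRightLin_apply, mulLeftLin_apply,
    f_eq_sum]
  have hM : ∀ (p : Fin 2) (q : Fin s),
      (P.transpose * ((Matrix.single i l (1 : F) : Matrix (Fin 2) (Fin s) F) * Q.transpose)) p q =
        P i p * Q q l := by
    intro p q
    rw [Matrix.mul_apply, Finset.sum_eq_single i (fun i' _ hi' => by
        rw [Matrix.single_mul_apply_of_ne (1 : F) i l i' q hi', mul_zero]) (by simp),
      Matrix.single_mul_apply_same, one_mul, Matrix.transpose_apply, Matrix.transpose_apply]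
  simp only [hM, Matrix.mul_apply, Finset.sum_mul]
  rw [Finset.sum_comm]
  exact Finset.sum_congr rfl fun q _ => Finset.sum_congr rfl fun p _ => by ring

end Twist

/-! ## The Theorem (case `s > n = 2`) -/

section Main

/-- The printed optimisation in `p` (proof of the Theorem, case `n = 2`, `s ≥ 3`), as an integer
certificate: from the two averaged counts to `(K^s + 1)(s + 1) m ≤ K^s d` (`Q = K^s`, `Q' = K^{s−1}`).
[cite: Nazarov2023FiniteFieldLB, Theorem (proof, pp. 47–49)] -/
private theorem arith (K Q Q' d M d0 d1 d2 Γ N1 N2 r1 r2 a1 b1 a2 b2 : ℤ) (hK : 2 ≤ K)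
    (hQ' : K ^ 2 ≤ Q') (hQ : Q = K * Q') (hd : d0 + d1 + d2 = d) (hd0 : 0 ≤ d0) (hΓ : 0 < Γ)
    (hr2 : r2 = (Q - 1) * (Q - K)) (horb : 1 + r1 + r2 = Q ^ 2)
    (hN1 : r1 * N1 = Γ) (hN2 : r2 * N2 = Γ)
    (ha1 : a1 + 1 = Q') (hb1 : b1 + Q' = Q) (ha2 : a2 + 1 = K) (hb2 : b2 + K = Q)
    (h1 : d0 * Γ + d1 * (a1 * N1) + d2 * (b1 * N2) + M * Γ ≤ d * Γ)
    (h2 : d0 * Γ + d1 * (a2 * N1) + d2 * (b2 * N2) + M * Γ ≤ d * Γ) :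
    (Q + 1) * M ≤ Q * d := by
  subst hQ
  have hr1 : r1 = (K + 1) * (K * Q' - 1) := by linear_combination horb - hr2
  have hK2 : 4 ≤ K ^ 2 := by nlinarith
  have hQ'2 : 4 ≤ Q' := le_trans hK2 hQ'
  have hKQ : 8 ≤ K * Q' := by nlinarith
  have hQK : 0 < Q' - K := by nlinarith
  have hr1pos : 0 < r1 := by rw [hr1]; exact mul_pos (by linarith) (by linarith)
  have hr2pos : 0 < r2 := by
    rw [hr2, show K * Q' - K = K * (Q' - 1) by ring]
    exact mul_pos (by linarith) (mul_pos (by linarith) (by linarith))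
  have hN2' : r2 * N2 = r1 * N1 := hN2.trans hN1.symm
  -- multiply by `r1 r2` and cancel `Γ`
  have X1le : d0 * (r1 * r2) + d1 * (a1 * r2) + d2 * (b1 * r1) + M * (r1 * r2) ≤ d * (r1 * r2) := by
    have hm := mul_le_mul_of_nonneg_right h1 (le_of_lt (mul_pos hr1pos hr2pos))
    have e : (d0 * Γ + d1 * (a1 * N1) + d2 * (b1 * N2) + M * Γ) * (r1 * r2) =
        Γ * (d0 * (r1 * r2) + d1 * (a1 * r2) + d2 * (b1 * r1) + M * (r1 * r2)) := by
      rw [← hN1]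
      linear_combination (d2 * b1 * r1) * hN2'
    have e' : d * Γ * (r1 * r2) = Γ * (d * (r1 * r2)) := by ring
    rw [e, e'] at hm
    exact le_of_mul_le_mul_left hm hΓ
  have X2le : d0 * (r1 * r2) + d1 * (a2 * r2) + d2 * (b2 * r1) + M * (r1 * r2) ≤ d * (r1 * r2) := by
    have hm := mul_le_mul_of_nonneg_right h2 (le_of_lt (mul_pos hr1pos hr2pos))
    have e : (d0 * Γ + d1 * (a2 * N1) + d2 * (b2 * N2) + M * Γ) * (r1 * r2) =
        Γ * (d0 * (r1 * r2) + d1 * (a2 * r2) + d2 * (b2 * r1) + M * (r1 * r2)) := by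
      rw [← hN1]
      linear_combination (d2 * b2 * r1) * hN2'
    have e' : d * Γ * (r1 * r2) = Γ * (d * (r1 * r2)) := by ring
    rw [e, e'] at hm
    exact le_of_mul_le_mul_left hm hΓ
  -- the certificate
  have ha : 0 ≤ 2 * K * (Q' - 1) := mul_nonneg (by linarith) (by linarith)
  have hb : 0 ≤ K * Q' * (Q' - K - 2) + Q' + K := by
    have : 0 ≤ Q' - K - 2 := by nlinarith
    have : 0 ≤ K * Q' * (Q' - K - 2) := mul_nonneg (by linarith) this
    linarith
  have P : 2 * K * (Q' - 1) * (d * (r1 * r2) -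
        (d0 * (r1 * r2) + d1 * (a1 * r2) + d2 * (b1 * r1) + M * (r1 * r2))) +
      (K * Q' * (Q' - K - 2) + Q' + K) * (d * (r1 * r2) -
        (d0 * (r1 * r2) + d1 * (a2 * r2) + d2 * (b2 * r1) + M * (r1 * r2))) =
      (K * Q' - 1) * (Q' - K) * (K * (K + 1) * (Q' - 1) * (K * Q' - 1)) *
        ((K * Q' + 1) * d - (K * Q' + 1) * (d0 + M) - d1 - d2) := by
    have ea1 : a1 = Q' - 1 := by linear_combination ha1
    have eb1 : b1 = K * Q' - Q' := by linear_combination hb1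
    have ea2 : a2 = K - 1 := by linear_combination ha2
    have eb2 : b2 = K * Q' - K := by linear_combination hb2
    rw [hr1, hr2, ea1, eb1, ea2, eb2]
    ring
  have hnn : 0 ≤ 2 * K * (Q' - 1) * (d * (r1 * r2) -
        (d0 * (r1 * r2) + d1 * (a1 * r2) + d2 * (b1 * r1) + M * (r1 * r2))) +
      (K * Q' * (Q' - K - 2) + Q' + K) * (d * (r1 * r2) -
        (d0 * (r1 * r2) + d1 * (a2 * r2) + d2 * (b2 * r1) + M * (r1 * r2))) :=
    add_nonneg (mul_nonneg ha (sub_nonneg.2 X1le)) (mul_nonneg hb (sub_nonneg.2 X2le))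
  rw [P] at hnn
  have hpos : 0 < (K * Q' - 1) * (Q' - K) * (K * (K + 1) * (Q' - 1) * (K * Q' - 1)) := by
    have h1' : 0 < K * Q' - 1 := by linarith
    have h3' : 0 < K * (K + 1) * (Q' - 1) * (K * Q' - 1) :=
      mul_pos (mul_pos (mul_pos (by linarith) (by linarith)) (by linarith)) h1'
    exact mul_pos (mul_pos h1' hQK) h3'
  have hfin := (mul_nonneg_iff_of_pos_left hpos).1 hnn
  have hQd0 : 0 ≤ K * Q' * d0 := mul_nonneg (by linarith) hd0
  linarith
set_option maxHeartbeats 400000 in -- buildfix (bf3-g27): 160k/180k FAIL, 200k PASS at accept time; line-neutral budget line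
/-- **Theorem (case `n = 2 < s`), for a computation**: a bilinear computation of `⟨2,s,m⟩`, `s ≥ 3`,
over a field with `K` elements has `d` terms with `K^s d ≥ (K^s + 1)(s + 1) m`.
[cite: Nazarov2023FiniteFieldLB, Theorem (case `s > n = 2`)] -/
theorem card_ge [Fintype F] [DecidableEq F] (hs : 3 ≤ s) (β : BilinComp (mulBilin F 2 s m) ι) :
    (Fintype.card F ^ s + 1) * ((s + 1) * m) ≤ Fintype.card F ^ s * Fintype.card ι := by
  classical
  have hs2 : 2 ≤ s := by omega
  have hK : 2 ≤ Fintype.card F := by have := Fintype.one_lt_card (α := F); omega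
  set K := Fintype.card F with hKdef
  let As := A β
  let Γn := Fintype.card (Γ F s)
  let E1 : Matrix (Fin 2) (Fin s) F := B1 hs2
  let E2 : Matrix (Fin 2) (Fin s) F := B2
  let r1 := (Finset.univ.filter (IsRk1 (F := F) (s := s))).card
  let r2 := (Finset.univ.filter (IsRk2 (F := F) (s := s))).card
  have hN1 : r1 * cnt E1 E1 = Γn := card_mul_cnt (isRk1_B1 hs2)
    (fun g => isRk1_act g (isRk1_B1 hs2)) (fun A hA => exists_act_B1_eq hs2 hA)
  have hN2 : r2 * cnt E2 E2 = Γn := card_mul_cnt (isRk2_B2 (F := F) hs2)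
    (fun g => isRk2_act g (isRk2_B2 hs2)) (fun A hA => exists_act_B2_eq hs2 hA)
  have hr2 : r2 = (K ^ s - 1) * (K ^ s - K) := card_rk2 (F := F) hs2
  have horb : 1 + r1 + r2 = (K ^ s) ^ 2 := card_orbits (F := F) (s := s)
  -- the three classes of indices
  let T0 : Finset ι := Finset.univ.filter fun t => As t = 0
  let T1 : Finset ι := Finset.univ.filter fun t => IsRk1 (As t)
  let T2 : Finset ι := Finset.univ.filter fun t => IsRk2 (As t)
  have hsplit : ∀ f : ι → ℕ, ∑ t, f t = ∑ t ∈ T0, f t + ∑ t ∈ T1, f t + ∑ t ∈ T2, f t := by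
    intro f
    rw [← Finset.sum_filter_add_sum_filter_not Finset.univ (fun t => As t = 0),
      ← Finset.sum_filter_add_sum_filter_not (Finset.univ.filter fun t => ¬As t = 0)
        (fun t => IsRk2 (As t)), Finset.filter_filter, Finset.filter_filter, add_assoc]
    have hT2 : (Finset.univ.filter fun t => ¬As t = 0 ∧ IsRk2 (As t)) = T2 := by
      ext t
      simp only [Finset.mem_filter, Finset.mem_univ, true_and, T2]
      constructor
      · exact fun h => h.2
      · intro h
        exact ⟨fun h0 => not_isRk2_of_row_eq_zero 0 (by rw [h0]; rfl) h, h⟩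
    have hT1 : (Finset.univ.filter fun t => ¬As t = 0 ∧ ¬IsRk2 (As t)) = T1 := by
      ext t; simp [T1, IsRk1]
    rw [hT1, hT2, add_comm (∑ t ∈ T2, f t)]
  have hd : T0.card + T1.card + T2.card = Fintype.card ι := by
    have := hsplit fun _ => 1
    simpa using this.symm
  -- type *
  obtain ⟨g1, hg1⟩ := exists_good As (IsTS (F := F) hs2)
  let β1 := twist β (g1.1 : Matrix (Fin 2) (Fin 2) F) (g1.2 : Matrix (Fin s) (Fin s) F)
    (Matrix.isUnits_det_units g1.1) (Matrix.isUnits_det_units g1.2)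
  have hZ1 : (Finset.univ.filter fun t => aS β1 hs2 t = 0) =
      Finset.univ.filter fun t => IsTS hs2 (act g1 (As t)) := by
    ext t
    simp only [Finset.mem_filter, Finset.mem_univ, true_and, IsTS]
    have e : aS β1 hs2 t = fun c => (act g1 (As t)) 1 c +
        if c = c0 hs2 then (act g1 (As t)) 0 (cl hs2) else 0 := by
      funext c
      simp only [aS, β1, A_twist, act_def]
      rfl
    rw [e]
  have hL7 := typeStar_bound β1 hs2
  rw [hZ1] at hL7
  have hS1 : T0.card * Γn + T1.card * ((K ^ (s - 1) - 1) * cnt E1 E1) +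
      T2.card * ((K ^ s - K ^ (s - 1)) * cnt E2 E2) ≤
      ∑ t, (Finset.univ.filter fun g : Γ F s => IsTS hs2 (act g (As t))).card := by
    rw [hsplit]
    refine add_le_add (add_le_add ?_ ?_) ?_
    · rw [← smul_eq_mul]
      refine Finset.card_nsmul_le_sum _ _ _ fun t ht => ?_
      have h0 : As t = 0 := (Finset.mem_filter.1 ht).2
      rw [h0, Finset.filter_true_of_mem (fun g _ => by
        simp only [act, Matrix.mul_zero, Matrix.zero_mul, IsTS, Matrix.zero_apply, ite_self, add_zero]
        rfl), Finset.card_univ]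
    · rw [← smul_eq_mul]
      refine Finset.card_nsmul_le_sum _ _ _ fun t ht => ?_
      have h := card_mul_cnt_le (IsTS hs2) IsRk1 (fun A hA => exists_act_B1_eq hs2 hA)
        (Finset.mem_filter.1 ht).2
      rwa [card_TS_rk1 hs2] at h
    · rw [← smul_eq_mul]
      refine Finset.card_nsmul_le_sum _ _ _ fun t ht => ?_
      have h := card_mul_cnt_le (IsTS hs2) IsRk2 (fun A hA => exists_act_B2_eq hs2 hA)
        (Finset.mem_filter.1 ht).2
      rwa [card_TS_rk2 hs2] at h
  have h1 : T0.card * Γn + T1.card * ((K ^ (s - 1) - 1) * cnt E1 E1) +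
      T2.card * ((K ^ s - K ^ (s - 1)) * cnt E2 E2) + (s + 1) * m * Γn ≤ Fintype.card ι * Γn := by
    have ha := hS1.trans hg1
    have hb := Nat.mul_le_mul_right Γn hL7
    nlinarith [ha, hb]
  -- type @
  obtain ⟨g2, hg2⟩ := exists_good As (IsTA (F := F) (s := s))
  let β2 := twist β (g2.1 : Matrix (Fin 2) (Fin 2) F) (g2.2 : Matrix (Fin s) (Fin s) F)
    (Matrix.isUnits_det_units g2.1) (Matrix.isUnits_det_units g2.2)
  have hZ2 : (Finset.univ.filter fun t => aA β2 t = 0) =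
      Finset.univ.filter fun t => IsTA (act g2 (As t)) := by
    ext t
    simp only [Finset.mem_filter, Finset.mem_univ, true_and, IsTA]
    have e : aA β2 t = fun c : Fin s => (act g2 (As t)) 0 c +
        if h : c.val + 1 < s then (act g2 (As t)) 1 ⟨c.val + 1, h⟩ else 0 := by
      funext c
      simp only [aA, β2, A_twist, act_def]
      rfl
    rw [e]
  have hL8 := typeAt_bound β2 hs2
  rw [hZ2] at hL8
  have hS2 : T0.card * Γn + T1.card * ((K - 1) * cnt E1 E1) +
      T2.card * ((K ^ s - K) * cnt E2 E2) ≤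
      ∑ t, (Finset.univ.filter fun g : Γ F s => IsTA (act g (As t))).card := by
    rw [hsplit]
    refine add_le_add (add_le_add ?_ ?_) ?_
    · rw [← smul_eq_mul]
      refine Finset.card_nsmul_le_sum _ _ _ fun t ht => ?_
      have h0 : As t = 0 := (Finset.mem_filter.1 ht).2
      rw [h0, Finset.filter_true_of_mem (fun g _ => by
        simp only [act, Matrix.mul_zero, Matrix.zero_mul, IsTA, Matrix.zero_apply, dite_eq_ite,
          ite_self, add_zero]
        rfl), Finset.card_univ]
    · rw [← smul_eq_mul]
      refine Finset.card_nsmul_le_sum _ _ _ fun t ht => ?_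
      have h := card_mul_cnt_le IsTA IsRk1 (fun A hA => exists_act_B1_eq hs2 hA)
        (Finset.mem_filter.1 ht).2
      rwa [card_TA_rk1 hs2] at h
    · rw [← smul_eq_mul]
      refine Finset.card_nsmul_le_sum _ _ _ fun t ht => ?_
      have h := card_mul_cnt_le IsTA IsRk2 (fun A hA => exists_act_B2_eq hs2 hA)
        (Finset.mem_filter.1 ht).2
      rwa [card_TA_rk2 hs2] at h
  have h2 : T0.card * Γn + T1.card * ((K - 1) * cnt E1 E1) +
      T2.card * ((K ^ s - K) * cnt E2 E2) + (s + 1) * m * Γn ≤ Fintype.card ι * Γn := by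
    have ha := hS2.trans hg2
    have hb := Nat.mul_le_mul_right Γn hL8
    nlinarith [ha, hb]
  -- to the integers
  have hKs : K ≤ K ^ s := by
    calc K = K ^ 1 := (pow_one K).symm
      _ ≤ K ^ s := Nat.pow_le_pow_right (by omega) (by omega)
  have hK1 : 1 ≤ K ^ (s - 1) := Nat.one_le_pow _ _ (by omega)
  have hKs' : K ^ (s - 1) ≤ K ^ s := Nat.pow_le_pow_right (by omega) (by omega)
  have hpow : K ^ s = K * K ^ (s - 1) := by
    rw [← pow_succ']
    congr 1
    omega
  have hΓpos : 0 < Γn := Fintype.card_pos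
  have hmain := arith (K : ℤ) ((K : ℤ) ^ s) ((K : ℤ) ^ (s - 1)) (Fintype.card ι) ((s + 1) * m)
    T0.card T1.card T2.card Γn (cnt E1 E1) (cnt E2 E2) r1 r2
    ((K ^ (s - 1) - 1 : ℕ) : ℤ) ((K ^ s - K ^ (s - 1) : ℕ) : ℤ) ((K - 1 : ℕ) : ℤ) ((K ^ s - K : ℕ) : ℤ)
    (by exact_mod_cast hK)
    (by
      have : K ^ 2 ≤ K ^ (s - 1) := Nat.pow_le_pow_right (by omega) (by omega)
      exact_mod_cast this)
    (by exact_mod_cast hpow) (by exact_mod_cast hd) (by positivity) (by exact_mod_cast hΓpos)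
    (by
      rw [hr2, Nat.cast_mul, Nat.cast_sub (Nat.one_le_pow _ _ (by omega)), Nat.cast_sub hKs]
      push_cast
      ring)
    (by exact_mod_cast horb) (by exact_mod_cast hN1) (by exact_mod_cast hN2)
    (by rw [Nat.cast_sub hK1]; push_cast; ring)
    (by rw [Nat.cast_sub hKs']; push_cast; ring)
    (by rw [Nat.cast_sub (by omega : 1 ≤ K)]; push_cast; ring)
    (by rw [Nat.cast_sub hKs]; push_cast; ring)
    (by exact_mod_cast h1) (by exact_mod_cast h2)
  have : ((K : ℤ) ^ s + 1) * ((s + 1) * m) ≤ (K : ℤ) ^ s * Fintype.card ι := by exact_mod_cast hmain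
  exact_mod_cast this

end Main

end Nazarov2023

/-! ## The Theorem and its corollaries -/

/-- **Nazarov 2023, Theorem, case `s > n = 2`** (integer form): over a finite field with `K` elements,
`K^s · R(⟨2,s,m⟩) ≥ (K^s + 1)(s + 1) · m` for `s ≥ 3` and every `m` (`f(K,2,s) = K^s + 1`).
[cite: Nazarov2023FiniteFieldLB, Theorem (case `s > n = 2`)] -/
theorem nazarov2023_rank_matMulTensor_2sm_ge (F : Type*) [Field F] [Fintype F] {s : ℕ} (hs : 3 ≤ s)
    (m : ℕ) : (Fintype.card F ^ s + 1) * ((s + 1) * m) ≤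
      Fintype.card F ^ s * tensorRank (matMulTensor F 2 s m) := by
  classical
  obtain ⟨β⟩ := exists_bilinComp_of_tensorRank_le (k := F) (c := 2) (m := s) (n := m) le_rfl
  have h := Nazarov2023.card_ge hs β
  rwa [Fintype.card_fin] at h

/-- **Nazarov 2023, Theorem, case `s > n = 2`** (as printed): `R(⟨2,s,m⟩) ≥ (s + 1)(1 + 1/K^s) m`.
[cite: Nazarov2023FiniteFieldLB, Theorem (case `s > n = 2`), eq. (7)] -/
theorem nazarov2023_rank_matMulTensor_2sm_ge' (F : Type*) [Field F] [Fintype F] {s : ℕ} (hs : 3 ≤ s)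
    (m : ℕ) : ((s : ℚ) + 1) * (1 + 1 / (Fintype.card F : ℚ) ^ s) * m ≤
      (tensorRank (matMulTensor F 2 s m) : ℚ) := by
  have h := nazarov2023_rank_matMulTensor_2sm_ge F hs m
  have hK : (0 : ℚ) < (Fintype.card F : ℚ) ^ s := by
    have := Fintype.one_lt_card (α := F)
    positivity
  have h' : ((Fintype.card F : ℚ) ^ s + 1) * (((s : ℚ) + 1) * m) ≤
      (Fintype.card F : ℚ) ^ s * (tensorRank (matMulTensor F 2 s m) : ℚ) := by
    exact_mod_cast h
  rw [show ((s : ℚ) + 1) * (1 + 1 / (Fintype.card F : ℚ) ^ s) * m =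
      ((Fintype.card F : ℚ) ^ s + 1) * (((s : ℚ) + 1) * m) / (Fintype.card F : ℚ) ^ s by
    field_simp, div_le_iff₀ hK]
  linarith

/-- **The named fact `nazarov2023_rank_matMulTensor_ge` in the case `n = 2 < s`**, in its own wording:
`(2 + s − 1)(1 + 1/(f(K,2,s) − 1)) m ≤ R(⟨2,s,m⟩)` with `f(K,2,s) = K^s + 1`.
[cite: Nazarov2023FiniteFieldLB, Theorem (case `s > n = 2`), eq. (7)] -/
theorem nazarov2023_rank_matMulTensor_ge_case_n2 (F : Type) [Field F] [Fintype F] (s m : ℕ)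
    (hs : 2 < s) :
    ((2 + s - 1 : ℕ) : ℚ) * (1 + 1 / (nazarov2023F (Fintype.card F) 2 s - 1)) * m ≤
      (tensorRank (matMulTensor F 2 s m) : ℚ) := by
  have hf : nazarov2023F (Fintype.card F) 2 s = (Fintype.card F : ℚ) ^ s + 1 := by
    unfold nazarov2023F
    rw [if_neg (by omega), if_neg (by omega), if_neg (by omega)]
  rw [hf, add_sub_cancel_right, show ((2 + s - 1 : ℕ) : ℚ) = (s : ℚ) + 1 by
    rw [show 2 + s - 1 = s + 1 by omega]; push_cast; ring]
  exact nazarov2023_rank_matMulTensor_2sm_ge' F hs m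

/-- **The named fact `nazarov2023_rank_matMulTensor_ge` for `n = 2` and every `s ≥ 2`** (both cases
`s = n = 2`, `f = K^s + 3` — Alekseev–Nazarov 2019, `alekseevNazarov2019_rank_matMulTensor_22m_ge'` — and
`s > n = 2`, `f = K^s + 1`, above), in the fact's own wording. The cases `n ≥ 3` remain a named fact.
[cite: Nazarov2023FiniteFieldLB, Theorem (cases `n = 2`), Remark (case `s = n = 2` = [2])] -/
theorem nazarov2023_rank_matMulTensor_ge_n2 (F : Type) [Field F] [Fintype F] (s m : ℕ) (hs : 2 ≤ s) :
    ((2 + s - 1 : ℕ) : ℚ) * (1 + 1 / (nazarov2023F (Fintype.card F) 2 s - 1)) * m ≤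
      (tensorRank (matMulTensor F 2 s m) : ℚ) := by
  rcases Nat.eq_or_lt_of_le hs with h2 | h2
  · subst h2
    have hf : nazarov2023F (Fintype.card F) 2 2 = (Fintype.card F : ℚ) ^ 2 + 3 := by
      unfold nazarov2023F
      rw [if_neg (by omega), if_neg (by omega), if_pos rfl]
    have hK : (0 : ℚ) < (Fintype.card F : ℚ) ^ 2 + 2 := by positivity
    rw [hf, show ((Fintype.card F : ℚ) ^ 2 + 3 - 1) = (Fintype.card F : ℚ) ^ 2 + 2 by ring,
      show ((2 + 2 - 1 : ℕ) : ℚ) * (1 + 1 / ((Fintype.card F : ℚ) ^ 2 + 2)) =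
        3 + 3 / ((Fintype.card F : ℚ) ^ 2 + 2) by push_cast; ring]
    exact alekseevNazarov2019_rank_matMulTensor_22m_ge' F m
  · exact nazarov2023_rank_matMulTensor_ge_case_n2 F s m h2

/-- Over a field with two elements: `8 · R(⟨2,3,m⟩) ≥ 36 m`, i.e. `2 R ≥ 9 m`
(beats the any-field `4m + 2` from `m = 5` on). [cite: Nazarov2023FiniteFieldLB, Theorem (K = 2, n = 2, s = 3)] -/
theorem nazarov2023_nine_mul_le_two_mul_tensorRank_matMulTensor_23m (F : Type) [Field F] [Fintype F]
    (hF : Fintype.card F = 2) (m : ℕ) : 9 * m ≤ 2 * tensorRank (matMulTensor F 2 3 m) := by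
  have h := nazarov2023_rank_matMulTensor_2sm_ge F (s := 3) le_rfl m
  rw [hF] at h
  norm_num at h
  omega

/-- In particular `R_𝔽₂(⟨2,3,5⟩) ≥ 23` (the any-field bound is `22`).
[cite: Nazarov2023FiniteFieldLB, Theorem (K = 2, n = 2, s = 3, m = 5)] -/
theorem nazarov2023_twentythree_le_tensorRank_matMulTensor_235 (F : Type) [Field F] [Fintype F]
    (hF : Fintype.card F = 2) : 23 ≤ tensorRank (matMulTensor F 2 3 5) := by
  have h := nazarov2023_nine_mul_le_two_mul_tensorRank_matMulTensor_23m F hF 5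
  omega

end Literature.Computability.AlgebraicComplexity
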